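import Mathlib
import HarnessLib
import Literature.Analysis.FluidPDE.LagrangianLatticeCarrier
import Literature.Analysis.FluidPDE.PassiveVectorTensor
import Literature.Analysis.FluidPDE.PassiveVectorTensorDistorted
import Summits.AnomalousDissipation.AnomalousDissipation.Theorems.SolenoidalFractalHomogenisationLagrangianStepDefs
import Summits.AnomalousDissipation.AnomalousDissipation.Theorems.SolenoidalFractalHomogenisationLagrangianStepOneLevelDefs
import Summits.AnomalousDissipation.AnomalousDissipation.Theorems.SolenoidalFractalHomogenisationLagrangianStepCellClauseCutsW
import Summits.AnomalousDissipation.AnomalousDissipation.Theorems.SolenoidalFractalHomogenisationLagrangianStepCellClauseCutsFamily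
import Summits.AnomalousDissipation.AnomalousDissipation.Theorems.SolenoidalFractalHomogenisationLagrangianStepFrameDefs  -- v2: §0 landed (p647381)
import Literature.Analysis.FunctionSpaces.TorusTrigPoly
import Literature.Analysis.FunctionSpaces.TorusDerivBounds
import Literature.Analysis.FluidPDE.PassiveVectorTensorPropagator   -- v6 §5: `Torus.IsPropagator` (S23″ text)
import Summits.AnomalousDissipation.AnomalousDissipation.Theorems.SolenoidalFractalHomogenisationLagrangianStepOneLevelSplitApiL   -- gridL/seqL (p4/g4)
import Summits.AnomalousDissipation.AnomalousDissipation.Theorems.SolenoidalFractalHomogenisationLagrangianStepExponents          -- conjunct 1 (TrimLevel) + Lg facts (lead)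
import Summits.AnomalousDissipation.AnomalousDissipation.Theorems.SolenoidalFractalHomogenisationLagrangianStepTemplateAsymptotics -- rho_le_half_pow (g4)
import Summits.AnomalousDissipation.AnomalousDissipation.Theorems.SolenoidalFractalHomogenisationLagrangianStepWindowLedgerAbs
import Summits.AnomalousDissipation.AnomalousDissipation.Theorems.SolenoidalFractalHomogenisationLagrangianStepLedgerDD
import Summits.AnomalousDissipation.AnomalousDissipation.Theorems.SolenoidalFractalHomogenisationLagrangianStepLedgerProfile
import Summits.AnomalousDissipation.AnomalousDissipation.Theorems.SolenoidalFractalHomogenisationLagrangianStepDecayEnergyComp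
import Summits.AnomalousDissipation.AnomalousDissipation.Theorems.SolenoidalFractalHomogenisationLagrangianStepOneLevelSplitDefsH   -- v18: HighLabelDecayW (landed p659807)

/-!
# K1L_D · S23′ `stub_windowDefectL` — the lead's SUB-SPLIT, v0: frame definitions + S1′ `stub_conjugateL` + S2′ `stub_distortedCellLawL`
# (typed against ad-lit's D3 `Torus.IsWeakTensorPassiveVectorDistortedOn`, p645449)

Line lead `lead-k1l-onelevel-p1` g2, 2026-08-28.  Crux `LagrangianRenormalisationStepDesign` (stmt-AnomalousDissipation-27980); v3 cut of record =
planner p4 g11's `Cruxes/LagrangianRenormalisationStep/OneLevelSplitSketch.lean` (S0′ `stub_windowPropagatorL`, S23′ `stub_windowDefectL` — MINE —,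
S3d′ `stub_fastContentL`, composition over `window_ledger_abs` p645039).  This file is NOT a registry and does NOT restate S23′; it types the two
analysis-heavy pieces INSIDE S23′ (spec: `Lines/onelevel-L3-stub-texts.md`, plan: `Lines/onelevel-S2prime-plan.md`) so that they can be attacked in
parallel, E-level (the frame is the carrier's own coarse flow `E.X m`, so no abstract flow package is needed and S2′'s duality proof may use the
physical picture `· ∘ X⁻¹` freely):

* §0 FRAME DEFS: `frameJac E m t w y` (the Jacobian matrix `(∂_c X_a)` of `E.X m t w` at `y`, read off `E.flowDeriv`), `frameG := (frameJac)⁻¹`,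
  `conjField E m w u s y := u s (E.X m (w+s) w y)` (plain composition — NOT divergence free: `div (frameG · conjField) = 0`, Piola).
* §1 S1′ `stub_conjugateL` (L/XL−): on a refresh window `[w, w+τ′]`, `w = j·refresh(m+1)`, (a) the frame is a small distortion
  (`‖flowDeriv − id‖ ≤ exp(Cd·strain m) − 1`, `‖∇G‖ ≲ (Σ aᵢNᵢ)·refresh`, time-Lipschitz, smooth, Piola); (b) every FLAT weak solution of the level-`m′`
  problem (`m ≤ m′`, restarted at `w`: carrier `s ↦ partialSum m′ (w+s)`) conjugates to a DISTORTED weak solution (D3) with carrier the pull-back of the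
  levels `m+1 … m′` (`= level (m+1) (w+·)` for `m′ = m+1` by `IsInserted`, `= 0` for `m′ = m` — cheap identifications outside the stub) and `G = frameG`;
  (c) the `H¹` seminorm transfers with the factor `exp(2·Cd·strain m)`.  Applied to u (m′ = m+1) AND v (m′ = m) with the SAME frame.
* §2 S2′ `stub_distortedCellLawL` (XL−): the slow-vector clause (V) SURVIVES the common distortion as a RATE error — (V_G): for the distorted cell
  solution ŵ := conjField u′ and the distorted effective solution v̂ := conjField v′ (frame images of the FLAT restarted solutions u′, v′ — v1: stated on
  frame images of physical solutions, NOT on arbitrary D3 solutions, so no well-posedness of the distorted class is owed and the prover has both pictures),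
  the frame sector-ℓ discrepancy obeys (V)'s bound with `e ↦ e + C₂δ`; (E_G): DRIFT-STABILITY — the level-`m` effective problem (coarse drift of one window)
  is `(1 ± C₂δ)`-dissipation-equivalent to the carrier-free one, `|‖v′ s‖² − ‖v s‖²| ≤ C₂δ·(‖σ₀‖² − ‖v s‖²)`, forward and adjoint (a FLAT statement).
  Inputs: the FLAT (V) only (+ energy layers); proof route (i) = global duality against frame images of PHYSICAL adjoint solutions (no ∇G pollution),
  forced energy estimate in dissipation form (ad-lit F1/F2), Poincaré on fast modes, bootstrap in δ.  The cross-sector (X_G), corrector-content (C_G)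
  and leak (F_G) companions are v2 additions (same shapes, see the spec).
* §3 (v2, finding F-lead-3) S1″ `stub_analyticFrameL` (the ANALYTIC distortion tower: geometric derivative growth of the window flows at scale
  1/N m — needed because the homogenised dynamics over-dissipates near-cell-scale modes, so u must be spectrally CONFINED below the band
  where (V) is void, and confinement across K_w resets needs analytic, not C^∞, control) + S3e′ `stub_resetSpreadL` (the reset-spread lemma it feeds).
v3 (F-lead-4): all windows may have length up to `2·refresh (m+1)` (the ledger's LAST window absorbs the remainder `t − ⌊t/r⌋·r`, so it has
length in `[r, 2r)`; a short last window would carry a non-dissipation-dominated corrector-build-up defect) — `τ' ≤ 2 * E.refresh (m+1)` in S1′/S2′ and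
`t, t' ∈ [j·r, (j+2)·r]` in S1″/S3e′ (strain ≤ 2θ: harmless).
v4 (p4 L4b H1): S3e′ assumes `Real.log (E.N (m+1)) ≤ q`.
v31 (lead g4, 2026-08-29T00:0xZ): §9z `cellInputs_bilinear_text` = THE BILINEAR CUT (one text replacing §9a/§9b/§9c; reduction kernel-checked: …CellInputsBilinear p679549, …CellInputsOfBilinearParts, …CellInputsOfBilinear; duality …WindowDuality p679212).
v30 (lead g3, 23:2xZ): F-k3l-5 binder re-cut of §4c — the strain ceiling is ALL-LEVELS `(∀ i, E.θ (i + 1) ≤ θ₁) → ∀ m,` (was the window level only); (i)/(ii) shapes unchanged; the assembly discharges it with θ₀ := min θ₀ θ₁ and (T4) (`windowFactsH_of_inputs₂`, …WindowFactsHAssemblyV2).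
v29 (lead g3, 22:4xZ): §9a–§9d provider-sized parts with canonical pieces (slow block / leak / fast / rec); `stub_windowFactsH` DISCHARGED by landed `windowFactsH_of_inputs` p672353 (registry v9 candidate).
v28 (lead g3, 21:4xZ): §9 `cellInputs_text` = the CELL-SIDE OPERATOR INPUTS of stub_windowFactsH (Zin pieces for z_of_pieces + Recin), binder-exact; next landing = `windowFactsH_of_inputs`.
v27 (lead g3, 21:1xZ): §4c (ii) tail in ENGINE-A currency `e^(−c₃/θ(m+1)) + e^(−(L−L')/(C₂N_m))` with `∃ c₃ > 0`, factor gap `2L' ≤ L` (p4 (4), k3l-endorsed); v26's J-form superseded.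
v26 (lead g3, F-k3l-3): §4c (ii) tail in DYADIC currency `(C₂ θ(m+1))^J` (superseded by v27).
v25 (lead g3, 21:1xZ): §4c W3-E binder deltas Δ0 (θ(m+1) ≤ θ₁)/Δ1 (2L' ≤ L)/Δ2 (s'−s ≤ 2 refresh) + M1 norm form (p4 memo 09b204bf6574).
v24 (lead g3, 21:0xZ): §8 text with the trim level PINNED `Lc = ⌊cap⌋₊` (bug fix: ∀ Lc ≤ cap over-asked (Hi) for small Lc); glue amendment `windowDefectH_of_windowFactsPinned` p667311.
v23 (lead g3, 20:5xZ, option (γ) of k3l review 9c1169823c76): §4c W3-E re-typed at PROPAGATOR level in PHYSICAL coordinates (flat; T ∈ {Um s s', (Um s s')†}; floor + band kill out/in) — D3 form superseded.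
v22 (lead g3, 2026-08-28T20:5xZ): §8 = the OPERATOR-LEVEL CUT (window facts (Z)(Hi)(Rec); S23‴ discharged by the landed glue p665050; v6 candidate) + §4c W3-E
(energy form of (E_G′) + (E_G⁺): what the glue consumes from W3 after F-k3l-1; lead ruling (C′) on D25-3).
v21 (D25-1): §6 statement switched to the Kb-FIX form of record (∀ Kb ≥ 1, ∃ CK cK νh, HighLabelDecayW … as ONE hypothesis; binders νh Kb CK cK dropped).
v20: §7 — the v4 Hilbert-space brick `window_ledger_split` is PROVED and landed (LedgerSplit p661019); spec block replaced by its signature.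
v19: §7 SPEC `window_ledger_split_spec` (superseded by v20).
v17 (R-hyp): every frame-level stub also carries the ENERGY INEQUALITY in dissipation form of its D3 solutions as a hypothesis (coefficient kbar·lo;
discharged at instantiation from `IsPropagator.energy_ineq_real′` + FrameMeasure + S1′(c)) — no class-level DE1 needed.
v16 (D24-23): §6 S23‴ `windowDefectH_text` (energy-comparison interface; hypothesis `HighLabelDecayW` = landed DefsH p659807) — S23″ superseded (v18: draft def removed).
v15: (E_G) energy-form conjuncts dropped from S2′ (redundant with (E_G′)); S2′ = (V_G) only.
v14: §2 (V_G)/(E_G) and §4 companions also restated at the FRAME level (D3 membership + L²H¹ as hypotheses; residual carrier of the cell problem =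
the Eulerian `level (m+1)`; aligned windows τ′ ≤ refresh) ⇒ W5/W6 decoupled from W1 too.
v13: §4b (E_G′) restated at the FRAME level (hypothesis: D3 membership + L²H¹; S1′ supplies it) — decouples W3 from W1.
v12: §4 companions retyped as OPERATOR/BILINEAR forms for SECTOR FAMILIES ((C_G⁺)(F_G⁺)(X_G⁺)(B_G⁺)) — distortion breaks sector orthogonality
(p4 g12 18:14Z); §4b (E_G′⁺) adds the fast-datum clause for the effective flow.
v8: §4b `stub_effectiveFrameTrackingL` (E_G′) = modal tracking of the distorted EFFECTIVE flow vs the explicit flat one (what the floors consume).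
v6: §5 `windowDefectL_of_subsplit` — the registered S23″ text with constants / m⋆ / conjuncts 1–2 PROVED and the core as one annotated sorry.
v5 (F-lead-6/7): §4 `stub_distortedCellCompanionsL` = (C_G) ∧ (F_G) ∧ (X_G) ∧ (B_G), the cell-side inputs of the UNCUT window ledger besides (V_G)/(E_G).
`lean check`: statements elaborate; sorries = the stubs.  NOT a proof of anything; AD NOT proved; rung F-D1.A0 infrastructure.
-/

set_option linter.dupNamespace false

namespace Summit.AnomalousDissipation.AnomalousDissipation.Cruxes.LagrangianRenormalisationStepDesign.OneLevelSplit.S23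

open Literature.Analysis Literature.Analysis.FluidPDE Literature.Analysis.FunctionSpaces
open MeasureTheory Set Filter
open scoped ENNReal NNReal InnerProductSpace

noncomputable section

open Summit.AnomalousDissipation.AnomalousDissipation.Theorems.SolenoidalFractalHomogenisation.LagrangianStep
open Summit.AnomalousDissipation.AnomalousDissipation.Theorems.SolenoidalFractalHomogenisation.LagrangianStep.OneLevelSplit

/-! ## §0 Frame definitions — LANDED as `…Theorems.SolenoidalFractalHomogenisationLagrangianStepFrameDefs` (p647381): `frameJac`, `frameG`,
`conjField`, `residualCarrier` are TREE declarations of the opened namespace `…LagrangianStep`; nothing is redeclared here (v2). -/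

/-! ## §1 S1′ — Lagrangian conjugation on one refresh window (for u AND v with the same flow) -/

/-- **S1′ `stub_conjugateL` (L/XL−).**  For every design there is a distortion constant `Cd` such that for every `L`-permissible regular carrier with
that design, every coarse level `m`, every finer level `m′ ≥ m`, every refresh window `[w, w + τ′]` of level `m+1` inside `[0,1]` (`w = j·refresh (m+1)`,
`0 < τ′ ≤ refresh (m+1)`):
(a) DISTORTION TOWER on the window — `‖flowDeriv m (w+s) w y − id‖ ≤ exp (Cd·strain m) − 1`, the inverse Jacobian `frameG` is entrywise within
    `exp (Cd·strain m) − 1` of `1`, smooth in `y` with `|∂_e G_{ac}| ≤ Cd·(Σ_{i<m} a(i+1)·N(i+1))·refresh(m+1)·exp(Cd·strain m)`, Lipschitz in `s` with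
    constant `Cd·(Σ_{i<m} a(i+1))·exp(Cd·strain m)`, jointly continuous, and satisfies the Piola identity `Σ_c ∂_c G_{ca} = 0`;
(b) CONJUGATION — every flat weak solution on `[0, τ′)` of the level-`m′` problem restarted at `w` conjugates, by plain composition with the flow, to a
    weak solution of the `frameG`-DISTORTED problem (D3) with the pulled-back residual carrier and the same datum;
(c) the `H¹` seminorm transfers: `eGradNormSq (û s) ≤ exp(2·Cd·strain m) · eGradNormSq (u s)`.
Tools: `norm_flowDeriv_sub_id_le_of_isFlow` (…LagrangianCarrierDistortion), `isWeaklyDivFree_pushforward_flowDeriv` / `fderiv_comp_displacement`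
(…LagrangianCarrierPushforward), LevelRegular (F1)(F2), the flat weak formulation for time-Lipschitz tests (ad-lit D3-bis), change of variables under
`measurePreserving_X`. -/
theorem stub_conjugateL : ∀ k (W : Literature.Analysis.FluidPDE.LatticeShear.LatticeWord k) (M : ℝ) (hM : 0 < M),
    ∃ Cd > (0:ℝ), ∀ E : Literature.Analysis.FluidPDE.LatticeShear.LagrangianLatticeCarrier k, E.design = W.stretch M hM →
      E.LPermissible → E.Regular →
      ∀ (m m' j : ℕ) (τ' : ℝ), m ≤ m' → 0 < τ' → τ' ≤ 2 * E.refresh (m + 1) → (j : ℝ) * E.refresh (m + 1) + τ' ≤ 1 →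
        -- (a) distortion tower on the window `[w, w + τ′]`, `w := j·refresh (m+1)`
        (∀ s ∈ Icc (0:ℝ) τ', ∀ y,
            ‖E.flowDeriv m ((j : ℝ) * E.refresh (m + 1) + s) ((j : ℝ) * E.refresh (m + 1)) y
                - ContinuousLinearMap.id ℝ (EuclideanSpace ℝ (Fin 3))‖ ≤ Real.exp (Cd * E.strain m) - 1) ∧
        (∀ s ∈ Icc (0:ℝ) τ', ∀ y (a c : Fin 3),
            |frameG E m ((j : ℝ) * E.refresh (m + 1) + s) ((j : ℝ) * E.refresh (m + 1)) y a c - (1 : Matrix (Fin 3) (Fin 3) ℝ) a c|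
              ≤ Real.exp (Cd * E.strain m) - 1) ∧
        (∀ s ∈ Icc (0:ℝ) τ', ∀ (a c : Fin 3),
            FunctionSpaces.Torus.IsSmooth (fun y => frameG E m ((j : ℝ) * E.refresh (m + 1) + s) ((j : ℝ) * E.refresh (m + 1)) y a c)) ∧
        (∀ s ∈ Icc (0:ℝ) τ', ∀ y (a c e : Fin 3),
            |FunctionSpaces.Torus.partialDeriv e (fun y => frameG E m ((j : ℝ) * E.refresh (m + 1) + s) ((j : ℝ) * E.refresh (m + 1)) y a c) y|
              ≤ Cd * (∑ i ∈ Finset.range m, E.a (i + 1) * E.N (i + 1)) * E.refresh (m + 1) * Real.exp (Cd * E.strain m)) ∧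
        (∀ s ∈ Icc (0:ℝ) τ', ∀ s' ∈ Icc (0:ℝ) τ', ∀ y (a c : Fin 3),
            |frameG E m ((j : ℝ) * E.refresh (m + 1) + s) ((j : ℝ) * E.refresh (m + 1)) y a c
                - frameG E m ((j : ℝ) * E.refresh (m + 1) + s') ((j : ℝ) * E.refresh (m + 1)) y a c|
              ≤ Cd * (∑ i ∈ Finset.range m, E.a (i + 1)) * Real.exp (Cd * E.strain m) * |s - s'|) ∧
        (Continuous fun p : ℝ × UnitAddTorus (Fin 3) =>
            frameG E m ((j : ℝ) * E.refresh (m + 1) + p.1) ((j : ℝ) * E.refresh (m + 1)) p.2) ∧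
        (∀ s ∈ Icc (0:ℝ) τ', ∀ y (a : Fin 3),
            ∑ c, FunctionSpaces.Torus.partialDeriv c
              (fun y => frameG E m ((j : ℝ) * E.refresh (m + 1) + s) ((j : ℝ) * E.refresh (m + 1)) y c a) y = 0) ∧
        -- (b) conjugation of flat weak solutions restarted at `w`
        (∀ (𝔸 : Torus.Visc4 (Fin 3)) (φ : VF) (u : ℝ → VF),
            Torus.IsWeakTensorPassiveVectorOn 0 τ' 𝔸 (fun s => E.partialSum m' ((j : ℝ) * E.refresh (m + 1) + s)) φ u →
            Torus.IsWeakTensorPassiveVectorDistortedOn 0 τ' 𝔸 (residualCarrier E m m' ((j : ℝ) * E.refresh (m + 1)))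
              (fun s => frameG E m ((j : ℝ) * E.refresh (m + 1) + s) ((j : ℝ) * E.refresh (m + 1))) φ
              (conjField E m ((j : ℝ) * E.refresh (m + 1)) u)) ∧
        -- (c) H¹ transfer
        (∀ (u : ℝ → VF) (s : ℝ), s ∈ Icc (0:ℝ) τ' →
            Torus.eGradNormSq (conjField E m ((j : ℝ) * E.refresh (m + 1)) u s)
              ≤ ENNReal.ofReal (Real.exp (2 * Cd * E.strain m)) * Torus.eGradNormSq (u s)) := by
  sorry

/-! ## §2 S2′ — the slow-vector clause survives the common distortion as a RATE error

v1 (lead g2, 16:2xZ): S2′ is stated on FRAME IMAGES OF PHYSICAL SOLUTIONS (`conjField` of flat weak solutions restarted at the window's left end),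
not on arbitrary solutions of the distorted class D3: this is exactly what S3′ feeds it (ŵ := conjField of the restarted u, v̂ := conjField of the
restarted v), it spares S2′ any well-posedness theory of the distorted class, and it hands the prover BOTH pictures (frame: D3 via S1′(b);
physical: flat classes) — route (i) needs both (tests = frame images of physical adjoint solutions).  (E_G) then becomes a FLAT statement:
drift-stability of the energy decay of the carrier-free effective problem under the coarse drift of one window. -/

/-- **S2′ `stub_distortedCellLawL` (XL−) = (V_G), physical units of level `m+1` — v14 FRAME-LEVEL ((E_G) energy form DROPPED in v15: the
assembly's floors consume the modal form (E_G′) of §4b via `floor_of_modal_tracking`, so W6 owes only (V_G)): the solutions are D3 members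
(cell problem: residual carrier = the Eulerian `level (m+1)`, frame `frameG`; effective problem: no carrier) with `L²H¹` bounds, on ALIGNED windows of
length ≤ `refresh (m+1)`; S1′ supplies membership of the actual frame images, the assembly composes merged windows (`track_compose`).**  From the FLAT slow-vector clause (V) alone there are
`C₂ ≥ 0`, `δ₀ > 0` such that, on any refresh window `[w, w+τ′]` (`w = j·refresh(m+1)`) of an `L`-permissible regular carrier with the design whose frame
distortion is entrywise `≤ δ ≤ δ₀` with `y`-gradient `≤ δ·N(m+1)` (S1′(a) under (T4)):
(V_G) for every window shape `S`, slow mode `ℓ`, polarisation `p ⊥ ℓ`, every FLAT weak solution `u'` of the level-`(m+1)` problem (carrier `partialSum (m+1)`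
      restarted at `w`, tensor `kbar (m+1) • S`) and every FLAT weak solution `v'` of the level-`m` EFFECTIVE problem (carrier `partialSum m` restarted at `w`,
      tensor `kbar m • renormStep (Φ ν) (gain/ν²) S`) from the datum `Re e_ℓ·p`: the FRAME sector-`ℓ` discrepancy of `conjField u'` and `conjField v'` obeys (V)'s
      decay-relative bound with the rate error `e ↦ e + C₂δ` (`ν = cellVisc (m+1)`, `n = N (m+1)`, physical rate `r̄ = a(m+1)·8π²|ℓ|²hiΛ(ν + c/ν)/n²`, burst = one
      physical period);
(E_G) DRIFT-STABILITY of the effective dissipation: for every `L²` weakly div-free datum `σ₀`, the flat level-`m` effective solution `v'` (drift `partialSum m`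
      restarted at `w`) and the flat CARRIER-FREE effective solution `v` from `σ₀` satisfy `|‖v' s‖² − ‖v s‖²| ≤ C₂δ·(‖σ₀‖² − ‖v s‖²)` for a.e. `s`; and the same
      for the ADJOINT pair (drift `−partialSum m (w + τ′ − ·)`, tensor `majorTranspose`), which is what bounds the ledger's `𝔇*` from below.
Proof route (i) (plan `Lines/onelevel-S2prime-plan.md`): exact dualities against frame images of PHYSICAL adjoint solutions, `z := ŵ − w` by the forced energy
estimate in dissipation form + Poincaré on fast modes, Φ's non-equivariance under strain as the genuine O(δ) rate error, bootstrap in δ. -/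
theorem stub_distortedCellLawL : ∀ k (W : Literature.Analysis.FluidPDE.LatticeShear.LatticeWord k) (M : ℝ) (hM : 0 < M) (c : ℝ), 0 < c →
    ∀ (Φ : ℝ → Torus.Visc4 (Fin 3) → Torus.Visc4 (Fin 3)) (lo hi Λ β σ C ν₀ K : ℝ),
      0 < lo → lo ≤ 1 → 1 ≤ hi → 1 < Λ → 0 ≤ β → 0 < σ → 0 ≤ C → 0 < ν₀ → 0 < K →
      SlowVectorClauseF W M hM c Φ lo hi Λ β σ C ν₀ K →
      ∃ C₂ : ℝ, 0 ≤ C₂ ∧ ∃ δ₀ > (0:ℝ),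
        ∀ E : Literature.Analysis.FluidPDE.LatticeShear.LagrangianLatticeCarrier k, E.design = W.stretch M hM → E.gain = c → E.nu0 ≤ ν₀ →
          E.LPermissible → E.Regular →
        ∀ (m j : ℕ) (τ' δ : ℝ), 0 < τ' → τ' ≤ E.refresh (m + 1) → (j : ℝ) * E.refresh (m + 1) + τ' ≤ 1 → 0 ≤ δ → δ ≤ δ₀ →
          -- the frame distortion hypotheses (outputs of S1′(a) under (T4)); v14: ALIGNED windows of length ≤ refresh only (the assembly composes
          -- the merged last window from two aligned pieces, `track_compose` p657102), and FRAME-LEVEL solutions (D3 membership as hypothesis)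
          (∀ s ∈ Icc (0:ℝ) τ', ∀ y (a c' : Fin 3),
              |frameG E m ((j : ℝ) * E.refresh (m + 1) + s) ((j : ℝ) * E.refresh (m + 1)) y a c' - (1 : Matrix (Fin 3) (Fin 3) ℝ) a c'| ≤ δ) →
          (∀ s ∈ Icc (0:ℝ) τ', ∀ y (a c' e : Fin 3),
              |FunctionSpaces.Torus.partialDeriv e
                  (fun y => frameG E m ((j : ℝ) * E.refresh (m + 1) + s) ((j : ℝ) * E.refresh (m + 1)) y a c') y| ≤ δ * E.N (m + 1)) →
        ∀ S : Torus.Visc4 (Fin 3), Torus.OddSmall S β → Torus.NearIso S lo hi →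
          Torus.OddSmall (Φ (E.cellVisc (m + 1)) S) β → Torus.NearIso (Φ (E.cellVisc (m + 1)) S) lo hi →
        -- (V_G)
        (∀ ℓ : Fin 3 → ℤ, ℓ ≠ 0 → ‖Torus.latticeVec ℓ‖ * (⌈K / E.cellVisc (m + 1)⌉₊ : ℝ) ≤ E.N (m + 1) →
          ∀ p : EuclideanSpace ℝ (Fin 3), ‖p‖ = 1 → ⟪p, Torus.latticeVec ℓ⟫_ℝ = 0 →
          ∀ uhat vhat : ℝ → VF,
            -- û: D3 solution of the CELL problem in the frame (residual carrier = the Eulerian level, `residualCarrier_succ`), L²H¹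
            Torus.IsWeakTensorPassiveVectorDistortedOn 0 τ' (E.kbar (m + 1) • S)
              (fun s => E.toFractalCarrierData.level (m + 1) ((j : ℝ) * E.refresh (m + 1) + s))
              (fun s => frameG E m ((j : ℝ) * E.refresh (m + 1) + s) ((j : ℝ) * E.refresh (m + 1)))
              (fun x => (UnitAddTorus.mFourier ℓ x).re • p) uhat →
            (∫⁻ s in Ioo 0 τ', FunctionSpaces.Torus.eGradNormSq (uhat s) < ⊤) →
            -- energy inequality in dissipation form (R-hyp, ad-lit g26 18:57Z; discharged from `IsPropagator.energy_ineq_real′` + FrameMeasure + S1′(c))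
            (∀ᵐ s ∂(volume.restrict (Ioo 0 τ')), ∫ x, ‖uhat s x‖ ^ 2
                + E.kbar (m + 1) * lo * ∫ τ in (0:ℝ)..s, (FunctionSpaces.Torus.eGradNormSq (uhat τ)).toReal
                ≤ ∫ x, ‖(UnitAddTorus.mFourier ℓ x).re • p‖ ^ 2) →
            -- v̂′: D3 solution of the EFFECTIVE problem in the frame (no carrier), L²H¹
            Torus.IsWeakTensorPassiveVectorDistortedOn 0 τ'
              (E.kbar m • renormStep (Φ (E.cellVisc (m + 1))) (E.gain / E.cellVisc (m + 1) ^ 2) S) (fun _ _ => 0)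
              (fun s => frameG E m ((j : ℝ) * E.refresh (m + 1) + s) ((j : ℝ) * E.refresh (m + 1)))
              (fun x => (UnitAddTorus.mFourier ℓ x).re • p) vhat →
            (∫⁻ s in Ioo 0 τ', FunctionSpaces.Torus.eGradNormSq (vhat s) < ⊤) →
            (∀ᵐ s ∂(volume.restrict (Ioo 0 τ')), ∫ x, ‖vhat s x‖ ^ 2
                + E.kbar m * lo * ∫ τ in (0:ℝ)..s, (FunctionSpaces.Torus.eGradNormSq (vhat τ)).toReal
                ≤ ∫ x, ‖(UnitAddTorus.mFourier ℓ x).re • p‖ ^ 2) →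
            ∀ᵐ s ∂(volume.restrict (Ioo 0 τ')),
              2 * ∑ i, ‖modeCoeff ℓ (fun x => uhat s x - vhat s x) i‖ ^ 2
                ≤ (C * ((C * (E.cellVisc (m + 1) ^ σ
                        + (‖Torus.latticeVec ℓ‖ * (⌈K / E.cellVisc (m + 1)⌉₊ : ℝ) / E.N (m + 1)) ^ σ) + C₂ * δ)
                      * min 1 ((E.a (m + 1) * (8 * Real.pi ^ 2 * ‖Torus.latticeVec ℓ‖ ^ 2 * (hi * Λ)
                          * (E.cellVisc (m + 1) + c / E.cellVisc (m + 1)) / (E.N (m + 1) : ℝ) ^ 2)) * s)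
                    + (E.a (m + 1) * (8 * Real.pi ^ 2 * ‖Torus.latticeVec ℓ‖ ^ 2 * (hi * Λ)
                          * (E.cellVisc (m + 1) + c / E.cellVisc (m + 1)) / (E.N (m + 1) : ℝ) ^ 2)) * E.physPeriod (m + 1))) ^ 2
                  * ∫ x, ‖(UnitAddTorus.mFourier ℓ x).re • p‖ ^ 2) := by
  sorry

/-! ## §3 (v2, finding F-lead-3) S1″ — the ANALYTIC distortion tower and the reset-spread (confinement) lemma

WHY (F-lead-3, lead g2 16:5xZ).  The homogenised dynamics OVER-dissipates near-cell-scale modes: at frame wavenumbers `|ℓ| ≳ n·ν/K` (the band where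
(V) is void) v's effective rate `kbar_m·|S′|·|ℓ|² ≈ kbar_{m+1}·g·|Φ S|·|ℓ|²` exceeds u's TRUE rate (bare `kbar_{m+1}|S||ℓ|²` plus cell sloshing, no
corrector mechanism at 2–K/ν cells per wavelength) by the factor `≈ g = c/ν² ≫ 1`.  So the one-level inequality `drop u ≥ (1−ε)·drop v` REQUIRES
that u carries only `ε·drop_v`-negligible energy in that band at every window start — SPECTRAL CONFINEMENT of u's slow part below `≈ nν/K`, i.e.
`λ_J := (nν/K)/L_diss ≥ √K·ρ^{−1/16} → ∞` dissipation lengths above v's dissipation scale `L_diss = N_m/√ν_m`.  No junk clause (J) can replace it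
(u genuinely decays SLOWER there).  Confinement follows from the Gaussian damping `exp(−(k² − k₀²)/(2L_diss²))` along the strain-driven climb of
wavenumbers PROVIDED each frame reset spreads Fourier support only multiplicatively by `(1 + O(θ))` plus an additive `O(N_m·log)` — which is an
oscillatory-integral / analyticity statement about the flow maps `X_m(t, w, ·)`: C^∞ bounds with uncontrolled growth in the order (all that
`LevelRegular` gives) are NOT enough (the number of resets K_w ≈ t·a_m/θ is astronomically large), geometric derivative growth
`‖∇^s X‖ ≤ θ·(Ca·N_m)^{s−1}·s!` (real-analyticity at scale 1/N_m, as Armstrong–Vicol (e.Xm.regbounds)) IS.  It holds IN FACT for every carrier the stub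
quantifies over (the levels are pushed-forward trigonometric layers, the flows are flows of analytic fields) but must be PROVED from `IsLagrangian` +
design + template by induction over the levels `≤ m` — sub-stub S1″ below; the confinement step it feeds is S3e′. -/

/-- **S1″ `stub_analyticFrameL` (L/XL−): the ANALYTIC distortion tower.**  For every design there is `Ca` such that for every `L`-permissible regular
carrier with that design on the (T4)/N² template (strain budgets `θ(i+1) ≤ θ₀ρ_i^{1/16}`, `θ₀ ≤ 1`), every coarse level `m` and every refresh window
of level `m+1`, the displacement of the coarse flow between any two times of the window has GEOMETRIC derivative growth at scale `1/N m`: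
`‖∂_{l} disp m t t′‖_∞ ≤ Ca·θ(m+1)·(Ca·N m)^{|l|−1}·|l|!` for every non-empty multi-index list `l` (first derivative = strain, each further derivative
costs `Ca·N m`).  Armstrong–Vicol (e.Xm.regbounds); proof = induction over levels `i ≤ m` (each level is the pushed-forward trigonometric layer of the
design by the previous flow; Cauchy/Faà di Bruno bookkeeping; ad-lit ParticleTrajectory* p626400/p628405 for the flow of a field with given bounds). -/
theorem stub_analyticFrameL : ∀ k (W : Literature.Analysis.FluidPDE.LatticeShear.LatticeWord k) (M : ℝ) (hM : 0 < M),
    ∃ Ca > (0:ℝ), ∀ E : Literature.Analysis.FluidPDE.LatticeShear.LagrangianLatticeCarrier k, E.design = W.stretch M hM →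
      E.LPermissible → E.Regular →
      ∀ θ₀ : ℝ, 0 < θ₀ → θ₀ ≤ 1 → (∀ i, E.θ (i + 1) * ((E.N (i + 1) : ℝ) / E.N i) ^ (1 / 16 : ℝ) ≤ θ₀) → (∀ i, E.N i ^ 2 ≤ E.N (i + 1)) →
      ∀ (m j : ℕ) (t t' : ℝ), t ∈ Icc ((j : ℝ) * E.refresh (m + 1)) (((j : ℝ) + 2) * E.refresh (m + 1)) →
        t' ∈ Icc ((j : ℝ) * E.refresh (m + 1)) (((j : ℝ) + 2) * E.refresh (m + 1)) →
        ∀ (l : List (Fin 3)), l ≠ [] → ∀ y : UnitAddTorus (Fin 3),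
          ‖FunctionSpaces.Torus.iterPartialDeriv l (E.disp m t t') y‖
            ≤ Ca * E.θ (m + 1) * (Ca * E.N m) ^ (l.length - 1) * (l.length.factorial : ℝ) := by
  sorry

/-- **S3e′ `stub_resetSpreadL` (L): a frame reset spreads Fourier support only by `(1 + Ca·θ)` times plus `Ca·N m` per unit of exponential gain.**
From S1″: composing a field band-limited to `|ℓ| ≤ L′` with a window flow map (either direction) puts at most `e^{−q}` of its energy above
`L ≥ (1 + Ca·θ(m+1))·L′ + Ca·(N m)·q`, for `q ≥ log N(m+1)` (v4, p4 H1: the Schur/Hilbert–Schmidt assembly of the per-coefficient oscillatory bounds pays a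
lattice-shell count `≤ log N(m+1)`, absorbed into `q`; downstream `q = c/(4ρ) ≫ log N(m+1)`) (non-stationary phase with analytic amplitude, 1-D periodic
integration by parts optimised in the order; the `s!`-growth of S1″ is what makes it exponential).  `Ca` here is THIS theorem's own constant (it must exceed
the bare distortion constant of `abs_frameJac_sub_one_le` by a margin, p4 H2 — nothing pins it from above).  Reset step of the confinement induction S3′(e). -/
theorem stub_resetSpreadL : ∀ k (W : Literature.Analysis.FluidPDE.LatticeShear.LatticeWord k) (M : ℝ) (hM : 0 < M),
    ∃ Ca > (0:ℝ), ∀ E : Literature.Analysis.FluidPDE.LatticeShear.LagrangianLatticeCarrier k, E.design = W.stretch M hM →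
      E.LPermissible → E.Regular →
      ∀ θ₀ : ℝ, 0 < θ₀ → θ₀ ≤ 1 → (∀ i, E.θ (i + 1) * ((E.N (i + 1) : ℝ) / E.N i) ^ (1 / 16 : ℝ) ≤ θ₀) → (∀ i, E.N i ^ 2 ≤ E.N (i + 1)) →
      ∀ (m j : ℕ) (t t' : ℝ), t ∈ Icc ((j : ℝ) * E.refresh (m + 1)) (((j : ℝ) + 2) * E.refresh (m + 1)) →
        t' ∈ Icc ((j : ℝ) * E.refresh (m + 1)) (((j : ℝ) + 2) * E.refresh (m + 1)) →
        ∀ (L' L : ℕ) (q : ℝ), 0 ≤ q → Real.log (E.N (m + 1)) ≤ q → (1 + Ca * E.θ (m + 1)) * L' + Ca * E.N m * q ≤ L →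
        ∀ g : VF, MemLp g 2 volume →
          ∫ x, ‖Torus.fourierTruncate L' g (E.X m t t' x)
                - Torus.fourierTruncate L (fun x => Torus.fourierTruncate L' g (E.X m t t' x)) x‖ ^ 2
            ≤ Real.exp (-q) * ∫ x, ‖Torus.fourierTruncate L' g x‖ ^ 2 := by
  sorry

/-! ## §4 (v5, F-lead-6/7) S2′ COMPANIONS — what the window ledger consumes from the cell side besides (V_G)/(E_G)

All four are stated, like (V_G), on FRAME IMAGES (`conjField`) of FLAT restarted solutions of the level-`(m+1)` problem on one window (and, for (X_G),
of the level-`m` effective problem), with the same design/clause/carrier/window/distortion/shape prefix as S2′; `N := N(m+1)/2` is the slow cut of the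
cell, `rate ℓ` the physical effective decay rate of slow mode `ℓ`, `x_ℓ = c|ℓ|²/(n²ν²)` the corrector fraction.  Used by S3′ in the UNCUT ledger
(F-lead-7: the ledger runs on the full state `u_j := Um1 0 w_j w₁`, so fast-mode errors are dissipation-dominated because the level-`m` dynamics kills
fast modes within a window):
(C_G) corrector size + decay of fast content after the datum: fast energy of the frame solution from a ONE-SECTOR datum `ζ` (slow mode `±ℓ` plus its
      fast partners) is `≤ 2e^{−2π²·lo·ν·a·s}·(fast energy of ζ) + (C + C₂δ)·x_ℓ·‖ζ‖²`;
(F_G) leak, sup form: from a purely FAST one-sector datum the slow energy generated is `≤ (C + C₂δ)·x_ℓ·‖ζ‖²`;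
(X_G) cross-sector transfer is a BILINEAR form bounded by `C₂δ ×` the geometric mean of the decay-weighted energies of source data and target test field
      (physical-space Cauchy–Schwarz on the `O(δ)` perturbation of the viscous form — NOT a Schur kernel);
(B_G) band suppression: the slow energy of the frame solution above `L″` at time `s` is at most `(e^{−2·rate_lo(L′)·s} + (tracking floor)²) ×` the datum's
      energy above `L′ < L″`, plus a hop tail `e^{−(L″−L′)/(C₂ N_m)}·‖σ‖²` (in-window couplings move frame wavenumbers by `±O(N_m)` per hop).
-/

/-- **S2′-companions `stub_distortedCellCompanionsL` (L/XL−), v12 OPERATOR FORMS: (C_G⁺) ∧ (F_G⁺) ∧ (X_G⁺) ∧ (B_G⁺)** on one refresh window,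
physical units of level `m+1`, under the prefix of `stub_distortedCellLawL`.  All four are stated for a SECTOR FAMILY: a sign-free finite set `F` of
slow representatives, data `ζf ℓ` (slow `±ℓ` part AND fast partners `±ℓ + n·ℤ³` allowed) and, by linearity, one flat restarted solution per sector
(`u′ ℓ` cell, `v′ ℓ` effective); outputs are summed over the family, so NO sector orthogonality is assumed of the distorted dynamics (p4 g12 L4c /
lead 18:15Z).  `P_N := fourierTruncate Ncut` is the slow cut of the cell; `σ_ℓ := P_N (ζf ℓ)` the slow part, `ζf ℓ − σ_ℓ` the fast part. -/
theorem stub_distortedCellCompanionsL : ∀ k (W : Literature.Analysis.FluidPDE.LatticeShear.LatticeWord k) (M : ℝ) (hM : 0 < M) (c : ℝ), 0 < c →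
    ∀ (Φ : ℝ → Torus.Visc4 (Fin 3) → Torus.Visc4 (Fin 3)) (lo hi Λ β σ C ν₀ K Cf νf Kf : ℝ),
      0 < lo → lo ≤ 1 → 1 ≤ hi → 1 < Λ → 0 ≤ β → 0 < σ → 0 ≤ C → 0 < ν₀ → 0 < K →
      SlowVectorClauseF W M hM c Φ lo hi Λ β σ C ν₀ K → 0 ≤ Cf → 0 < νf → 0 < Kf → CellEnergyClausesW W M hM c lo hi Λ β Cf νf Kf →
      ∃ C₂ : ℝ, 1 ≤ C₂ ∧ ∃ δ₀ > (0:ℝ),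
        ∀ E : Literature.Analysis.FluidPDE.LatticeShear.LagrangianLatticeCarrier k, E.design = W.stretch M hM → E.gain = c → E.nu0 ≤ min ν₀ νf →
          E.LPermissible → E.Regular →
        ∀ (m j : ℕ) (τ' δ : ℝ), 0 < τ' → τ' ≤ E.refresh (m + 1) → (j : ℝ) * E.refresh (m + 1) + τ' ≤ 1 → 0 ≤ δ → δ ≤ δ₀ →
          (∀ s ∈ Icc (0:ℝ) τ', ∀ y (a c' : Fin 3),
              |frameG E m ((j : ℝ) * E.refresh (m + 1) + s) ((j : ℝ) * E.refresh (m + 1)) y a c' - (1 : Matrix (Fin 3) (Fin 3) ℝ) a c'| ≤ δ) →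
          (∀ s ∈ Icc (0:ℝ) τ', ∀ y (a c' e : Fin 3),
              |FunctionSpaces.Torus.partialDeriv e
                  (fun y => frameG E m ((j : ℝ) * E.refresh (m + 1) + s) ((j : ℝ) * E.refresh (m + 1)) y a c') y| ≤ δ * E.N (m + 1)) →
        ∀ S : Torus.Visc4 (Fin 3), Torus.OddSmall S β → Torus.NearIso S lo hi →
          Torus.OddSmall (Φ (E.cellVisc (m + 1)) S) β → Torus.NearIso (Φ (E.cellVisc (m + 1)) S) lo hi →
        let w : ℝ := (j : ℝ) * E.refresh (m + 1)
        let n : ℝ := E.N (m + 1)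
        let ν : ℝ := E.cellVisc (m + 1)
        let Ncut : ℕ := E.N (m + 1) / 2
        let rate : (Fin 3 → ℤ) → ℝ := fun ℓ =>
          E.a (m + 1) * (8 * Real.pi ^ 2 * ‖Torus.latticeVec ℓ‖ ^ 2 * (hi * Λ) * (ν + c / ν) / n ^ 2)
        let xfrac : (Fin 3 → ℤ) → ℝ := fun ℓ => c * ‖Torus.latticeVec ℓ‖ ^ 2 / (n ^ 2 * ν ^ 2)
        let 𝔸 : Torus.Visc4 (Fin 3) := E.kbar (m + 1) • S
        let 𝔼 : Torus.Visc4 (Fin 3) := E.kbar m • renormStep (Φ ν) (E.gain / ν ^ 2) S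
        let Gfwd : ℝ → UnitAddTorus (Fin 3) → Matrix (Fin 3) (Fin 3) ℝ := fun s => frameG E m (w + s) w
        -- a SECTOR FAMILY: sign-free slow representatives, sector-supported `L²` div-free data, one FRAME (D3) solution per sector (v14)
        ∀ (F : Finset (Fin 3 → ℤ)) (ζf : (Fin 3 → ℤ) → VF) (u' v' : (Fin 3 → ℤ) → ℝ → VF),
          (∀ ℓ ∈ F, ℓ ≠ 0 ∧ -ℓ ∉ F ∧ ‖Torus.latticeVec ℓ‖ * (⌈K / ν⌉₊ : ℝ) ≤ n ∧ MemLp (ζf ℓ) 2 volume ∧ Torus.IsWeaklyDivFree (ζf ℓ) ∧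
              (∀ k' : Fin 3 → ℤ, (∀ z : Fin 3 → ℤ, k' ≠ ℓ + (E.N (m + 1) : ℤ) • z) → (∀ z : Fin 3 → ℤ, k' ≠ -ℓ + (E.N (m + 1) : ℤ) • z) →
                UnitAddTorus.mFourierCoeff (EuclideanSpace.complexify ∘ ζf ℓ) k' = 0) ∧
              Torus.IsWeakTensorPassiveVectorDistortedOn 0 τ' 𝔸 (fun s => E.toFractalCarrierData.level (m + 1) (w + s)) Gfwd (ζf ℓ) (u' ℓ) ∧
              (∫⁻ s in Ioo 0 τ', FunctionSpaces.Torus.eGradNormSq (u' ℓ s) < ⊤) ∧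
              (∀ᵐ s ∂(volume.restrict (Ioo 0 τ')), ∫ x, ‖u' ℓ s x‖ ^ 2
                  + E.kbar (m + 1) * lo * ∫ τ in (0:ℝ)..s, (FunctionSpaces.Torus.eGradNormSq (u' ℓ τ)).toReal ≤ ∫ x, ‖ζf ℓ x‖ ^ 2) ∧
              Torus.IsWeakTensorPassiveVectorDistortedOn 0 τ' 𝔼 (fun _ _ => 0) Gfwd (ζf ℓ) (v' ℓ) ∧
              (∫⁻ s in Ioo 0 τ', FunctionSpaces.Torus.eGradNormSq (v' ℓ s) < ⊤) ∧
              (∀ᵐ s ∂(volume.restrict (Ioo 0 τ')), ∫ x, ‖v' ℓ s x‖ ^ 2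
                  + E.kbar m * lo * ∫ τ in (0:ℝ)..s, (FunctionSpaces.Torus.eGradNormSq (v' ℓ τ)).toReal ≤ ∫ x, ‖ζf ℓ x‖ ^ 2)) →
        -- (C_G⁺) fast OUTPUT energy of the family's cell solution: decayed fast input + correctors
        (∀ᵐ s ∂(volume.restrict (Ioo 0 τ')),
          ∫ x, ‖∑ ℓ ∈ F, (u' ℓ s x - Torus.fourierTruncate Ncut (u' ℓ s) x)‖ ^ 2
            ≤ 2 * Real.exp (-(2 * Real.pi ^ 2 * lo * ν * E.a (m + 1) * s)) * ∑ ℓ ∈ F, ∫ x, ‖ζf ℓ x - Torus.fourierTruncate Ncut (ζf ℓ) x‖ ^ 2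
              + (C + C₂ * δ) * ∑ ℓ ∈ F, xfrac ℓ * ∫ x, ‖ζf ℓ x‖ ^ 2) ∧
        -- (F_G⁺) x-WEIGHTED slow OUTPUT of a purely FAST family (leak, operator form)
        ((∀ ℓ ∈ F, Torus.fourierTruncate Ncut (ζf ℓ) = 0) →
          ∀ᵐ s ∂(volume.restrict (Ioo 0 τ')),
            ∑ ℓ' ∈ (FunctionSpaces.Torus.freqBall Ncut).erase 0,
                (2 * ∑ i, ‖modeCoeff ℓ' (fun x => ∑ ℓ ∈ F, u' ℓ s x) i‖ ^ 2) / xfrac ℓ'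
              ≤ (C + C₂ * δ) * ∑ ℓ ∈ F, ∫ x, ‖ζf ℓ x‖ ^ 2) ∧
        -- (X_G⁺) cross-sector part of the cell/effective discrepancy: bilinear, sources weighted by decay (slow part) + full fast part
        (∀ y : VF, MemLp y 2 volume →
          ∀ᵐ s ∂(volume.restrict (Ioo 0 τ')),
            |∫ x, ⟪y x, ∑ ℓ ∈ F,
                (Torus.fourierTruncate Ncut (fun x => u' ℓ s x - v' ℓ s x) x
                  - Torus.realTrigPoly ({ℓ, -ℓ} : Finset (Fin 3 → ℤ))
                      (fun k' => UnitAddTorus.mFourierCoeff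
                        (EuclideanSpace.complexify ∘ fun x => u' ℓ s x - v' ℓ s x) k') x)⟫_ℝ|
              ≤ C₂ * δ * Real.sqrt (∑ ℓ ∈ F, (min 1 (rate ℓ * s) * ∫ x, ‖Torus.fourierTruncate Ncut (ζf ℓ) x‖ ^ 2
                                        + ∫ x, ‖ζf ℓ x - Torus.fourierTruncate Ncut (ζf ℓ) x‖ ^ 2))
                * Real.sqrt (∑ ℓ' ∈ FunctionSpaces.Torus.freqBall Ncut,
                    min 1 (rate ℓ' * s) * ‖UnitAddTorus.mFourierCoeff (EuclideanSpace.complexify ∘ y) ℓ'‖ ^ 2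
                    + ∫ x, ‖y x - Torus.fourierTruncate Ncut y x‖ ^ 2)) ∧
        -- (B_G⁺) band suppression, two-component: slow band above `L″` from slow input above `L′`, from fast input (x-weighted), hop tail
        (∀ (L' L'' : ℕ), L' ≤ L'' → L'' ≤ Ncut → (L'' : ℝ) * (⌈K / ν⌉₊ : ℝ) ≤ n →
          ∀ᵐ s ∂(volume.restrict (Ioo 0 τ')),
            ∫ x, ‖∑ ℓ ∈ F, (Torus.fourierTruncate Ncut (u' ℓ s) x - Torus.fourierTruncate L'' (u' ℓ s) x)‖ ^ 2
              ≤ (Real.exp (-(2 * (E.a (m + 1) * (8 * Real.pi ^ 2 * (L' : ℝ) ^ 2 * (lo / Λ) * (ν + c / ν) / n ^ 2)) * s))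
                    + (C * (C * (ν ^ σ + ((L'' : ℝ) * (⌈K / ν⌉₊ : ℝ) / n) ^ σ) + C₂ * δ)) ^ 2)
                  * ∫ x, ‖∑ ℓ ∈ F, (Torus.fourierTruncate Ncut (ζf ℓ) x - Torus.fourierTruncate L' (ζf ℓ) x)‖ ^ 2
                + (C + C₂ * δ) * ∑ ℓ ∈ F, xfrac ℓ * ∫ x, ‖ζf ℓ x - Torus.fourierTruncate Ncut (ζf ℓ) x‖ ^ 2
                + Real.exp (-(((L'' : ℝ) - L') / (C₂ * E.N m))) * ∑ ℓ ∈ F, ∫ x, ‖ζf ℓ x‖ ^ 2) := by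
  sorry

/-! ## §4b (v8) (E_G′) — MODAL tracking of the distorted EFFECTIVE flow (the form the assembly's dissipation floors actually consume)

The ledger needs `𝔇_j(σ) = ‖σ‖² − ‖T_j σ‖² ≥ c·Σ_ℓ min(1, r̄_ℓ τ)|σ_ℓ|²` (and the adjoint twin).  With `dissip_lower_of_tracking` (LedgerModes p646016) this
follows from MODAL tracking of the frame image `v̂′ = conjField v′` of the level-`m` effective solution against the EXPLICIT carrier-free flat effective
solution `v` from the same datum (`effective_modeCoeff_eq`, cellLawV-w1 p646253) with a dissipation-dominated error — i.e. (V_G) with `u′` replaced by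
`v′` and the homogenisation rate error `e` replaced by `0`: only the `O(δ)` distortion of the viscous form acts.  This is the part of S2′ with NO cell
physics in it (distorted anisotropic heat flow with smooth drift-free frame), the natural first target for the (E_G) worker (w-b); (E_G) in energy form
is its corollary. -/

/-- **(E_G′) `stub_effectiveFrameTrackingL` (L), v13 FRAME-LEVEL form: modal tracking of the distorted effective flow.**  Stated directly for
solutions of ad-lit's distorted class D3 (no carrier, distortion `G` = the window frame, tensor 𝔼) with an `L²H¹` bound — membership of the actual
frame images `conjField v′` is S1′(b)+(c)'s business (W1), so THIS stub needs no conjugation: W3 = D3 + «DistortedEnergy» (DE1) + DistortedDuality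
(DE2, p657666) + the explicit flat modal solutions.  Forward: frame `G s = frameG E m (w+s) w`; adjoint twin: tensor `majorTranspose 𝔼`, frame
`G s = frameG E m (w+τ′−s) w`; fast clause: a purely fast datum is killed up to `O(δ)` and leaks super-little below `N/4`. -/
theorem stub_effectiveFrameTrackingL : ∀ k (W : Literature.Analysis.FluidPDE.LatticeShear.LatticeWord k) (M : ℝ) (hM : 0 < M) (c : ℝ), 0 < c →
    ∀ (Φ : ℝ → Torus.Visc4 (Fin 3) → Torus.Visc4 (Fin 3)) (lo hi β : ℝ), 0 < lo → lo ≤ 1 → 1 ≤ hi → 0 ≤ β →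
      ∃ C₂ : ℝ, 0 ≤ C₂ ∧ ∃ δ₀ > (0:ℝ),
        ∀ E : Literature.Analysis.FluidPDE.LatticeShear.LagrangianLatticeCarrier k, E.design = W.stretch M hM → E.gain = c →
          E.LPermissible → E.Regular →
        ∀ (m j : ℕ) (τ' δ : ℝ), 0 < τ' → τ' ≤ 2 * E.refresh (m + 1) → (j : ℝ) * E.refresh (m + 1) + τ' ≤ 1 → 0 ≤ δ → δ ≤ δ₀ →
          (∀ s ∈ Icc (0:ℝ) τ', ∀ y (a c' : Fin 3),
              |frameG E m ((j : ℝ) * E.refresh (m + 1) + s) ((j : ℝ) * E.refresh (m + 1)) y a c' - (1 : Matrix (Fin 3) (Fin 3) ℝ) a c'| ≤ δ) →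
          (∀ s ∈ Icc (0:ℝ) τ', ∀ y (a c' e : Fin 3),
              |FunctionSpaces.Torus.partialDeriv e
                  (fun y => frameG E m ((j : ℝ) * E.refresh (m + 1) + s) ((j : ℝ) * E.refresh (m + 1)) y a c') y| ≤ δ * E.N (m + 1)) →
        ∀ S : Torus.Visc4 (Fin 3), Torus.OddSmall (Φ (E.cellVisc (m + 1)) S) β → Torus.NearIso (Φ (E.cellVisc (m + 1)) S) lo hi →
        let w : ℝ := (j : ℝ) * E.refresh (m + 1)
        let n : ℝ := E.N (m + 1)
        let ν : ℝ := E.cellVisc (m + 1)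
        let rate : (Fin 3 → ℤ) → ℝ := fun ℓ =>
          E.a (m + 1) * (8 * Real.pi ^ 2 * ‖Torus.latticeVec ℓ‖ ^ 2 * (hi * (1 + β)) * (ν + c / ν) / n ^ 2)
        let 𝔼 : Torus.Visc4 (Fin 3) := E.kbar m • renormStep (Φ ν) (E.gain / ν ^ 2) S
        let Gfwd : ℝ → UnitAddTorus (Fin 3) → Matrix (Fin 3) (Fin 3) ℝ := fun s => frameG E m (w + s) w
        let Gbwd : ℝ → UnitAddTorus (Fin 3) → Matrix (Fin 3) (Fin 3) ℝ := fun s => frameG E m (w + τ' - s) w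
        -- forward: a D3 solution (no carrier, frame Gfwd, tensor 𝔼, L²H¹) from the single mode `Re e_ℓ · p` tracks the flat drift-free solution
        (∀ ℓ : Fin 3 → ℤ, ℓ ≠ 0 → ∀ p : EuclideanSpace ℝ (Fin 3), ‖p‖ = 1 → ⟪p, Torus.latticeVec ℓ⟫_ℝ = 0 →
          ∀ what v : ℝ → VF,
            Torus.IsWeakTensorPassiveVectorDistortedOn 0 τ' 𝔼 (fun _ _ => 0) Gfwd (fun x => (UnitAddTorus.mFourier ℓ x).re • p) what →
            (∫⁻ s in Ioo 0 τ', FunctionSpaces.Torus.eGradNormSq (what s) < ⊤) →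
            (∀ᵐ s ∂(volume.restrict (Ioo 0 τ')), ∫ x, ‖what s x‖ ^ 2
                + E.kbar m * lo * ∫ τ in (0:ℝ)..s, (FunctionSpaces.Torus.eGradNormSq (what τ)).toReal
                ≤ ∫ x, ‖(UnitAddTorus.mFourier ℓ x).re • p‖ ^ 2) →
            Torus.IsWeakTensorPassiveVectorOn 0 τ' 𝔼 (fun _ _ => 0) (fun x => (UnitAddTorus.mFourier ℓ x).re • p) v →
            ∀ᵐ s ∂(volume.restrict (Ioo 0 τ')),
              2 * ∑ i, ‖modeCoeff ℓ (fun x => what s x - v s x) i‖ ^ 2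
                ≤ (C₂ * δ * min 1 (rate ℓ * s)) ^ 2 * ∫ x, ‖(UnitAddTorus.mFourier ℓ x).re • p‖ ^ 2) ∧
        -- adjoint twin: transposed tensor, backward frame
        (∀ ℓ : Fin 3 → ℤ, ℓ ≠ 0 → ∀ p : EuclideanSpace ℝ (Fin 3), ‖p‖ = 1 → ⟪p, Torus.latticeVec ℓ⟫_ℝ = 0 →
          ∀ what v : ℝ → VF,
            Torus.IsWeakTensorPassiveVectorDistortedOn 0 τ' (Torus.majorTranspose 𝔼) (fun _ _ => 0) Gbwd
              (fun x => (UnitAddTorus.mFourier ℓ x).re • p) what →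
            (∫⁻ s in Ioo 0 τ', FunctionSpaces.Torus.eGradNormSq (what s) < ⊤) →
            (∀ᵐ s ∂(volume.restrict (Ioo 0 τ')), ∫ x, ‖what s x‖ ^ 2
                + E.kbar m * lo * ∫ τ in (0:ℝ)..s, (FunctionSpaces.Torus.eGradNormSq (what τ)).toReal
                ≤ ∫ x, ‖(UnitAddTorus.mFourier ℓ x).re • p‖ ^ 2) →
            Torus.IsWeakTensorPassiveVectorOn 0 τ' (Torus.majorTranspose 𝔼) (fun _ _ => 0) (fun x => (UnitAddTorus.mFourier ℓ x).re • p) v →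
            ∀ᵐ s ∂(volume.restrict (Ioo 0 τ')),
              2 * ∑ i, ‖modeCoeff ℓ (fun x => what s x - v s x) i‖ ^ 2
                ≤ (C₂ * δ * min 1 (rate ℓ * s)) ^ 2 * ∫ x, ‖(UnitAddTorus.mFourier ℓ x).re • p‖ ^ 2) ∧
        -- fast clause: a purely FAST datum under the distorted effective flow (either frame)
        (∀ G : ℝ → UnitAddTorus (Fin 3) → Matrix (Fin 3) (Fin 3) ℝ, (G = Gfwd ∨ G = Gbwd) →
          ∀ 𝔹 : Torus.Visc4 (Fin 3), (𝔹 = 𝔼 ∨ 𝔹 = Torus.majorTranspose 𝔼) →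
          ∀ ζ : VF, MemLp ζ 2 volume → Torus.IsWeaklyDivFree ζ → Torus.fourierTruncate (E.N (m + 1) / 2) ζ = 0 →
          ∀ what : ℝ → VF, Torus.IsWeakTensorPassiveVectorDistortedOn 0 τ' 𝔹 (fun _ _ => 0) G ζ what →
            (∫⁻ s in Ioo 0 τ', FunctionSpaces.Torus.eGradNormSq (what s) < ⊤) →
            (∀ᵐ s ∂(volume.restrict (Ioo 0 τ')), ∫ x, ‖what s x‖ ^ 2
                + E.kbar m * lo * ∫ τ in (0:ℝ)..s, (FunctionSpaces.Torus.eGradNormSq (what τ)).toReal ≤ ∫ x, ‖ζ x‖ ^ 2) →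
            ∀ᵐ s ∂(volume.restrict (Ioo 0 τ')),
              ∫ x, ‖what s x‖ ^ 2
                  ≤ (2 * Real.exp (-(2 * Real.pi ^ 2 * lo * E.kbar (m + 1) * n ^ 2 * s)) + (C₂ * δ) ^ 2) * ∫ x, ‖ζ x‖ ^ 2 ∧
              ∫ x, ‖Torus.fourierTruncate (E.N (m + 1) / 4) (what s) x‖ ^ 2
                  ≤ (C₂ * δ) ^ 2 * Real.exp (-(n / (C₂ * E.N m))) * ∫ x, ‖ζ x‖ ^ 2) := by
  sorry

/-! ## §4c (v25, lead g3 — option (γ) + p4 g13's binder deltas Δ0/Δ1/Δ2 + M1, memo `Lines/onelevel-W3E-review-p4.md` 09b204bf6574)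
W3-E at PROPAGATOR level, PHYSICAL coordinates: what the operator glue consumes from W3 is a statement about the PHYSICAL coarse window maps
`Um s s'` of the S23‴ text and their `L²`-adjoints — no frame, no D3: (i) a dissipation FLOOR (feeds (Z)'s weights `𝔇(u)`, `𝔇*(y)` through
`dd_assembly_op`), (ii) BAND KILL with hop tail, output and input form, in NORM form (feeds (Hi): `‖Q∘T‖, ‖T∘Q‖, ‖T†∘Q‖ ≤ ε` for the label class
`Q` = labels `> Lc/2`, whose frequencies are `> Lc/2`).  Binder deltas of record (p4, all three were blocking for truth-as-typed in regimes no consumer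
visits): Δ0 STRAIN SMALLNESS `E.θ (m+1) ≤ θ₁` with `θ₁` chosen together with `C₂` (a smooth strain `ϑ` moves wave-vectors multiplicatively, Bessel
plateau out to `ϑ|ξ|`; the consumer has (T4) so `θ(m+1) ≤ θ₁` for `m ≥ m⋆`); Δ1 FACTOR GAP `2L' ≤ L` (the additive hop tail is the right law only beyond
the multiplicative spread; (Hi) uses `L = Lc/2`, `L' = Lc/4`); Δ2 WINDOW LENGTH `s' − s ≤ 2·refresh (m+1)` (whole level-`m` slots have strain `≫ 1`;
every consumer lives on grid windows).  Mechanism/proof route: flat modewise machinery (`PassiveVectorTensorFourier/GalerkinIdentity/EnergyDecay`,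
`IsPropagator.energy_ineq/fast_kill`, `PropagatorDuality` for the adjoint) + the dyadic/Bessel ladder across the `≤ 2·3720` slots of a window,
`C₂ := 2|m|_max/ln(1/(2eθ₁|m|_max))` (p4 §2).  `rateLo L = a·8π²·L²·lo·(ν + c/ν)/n²` = modal rate of `NearIso 𝔼 (kbar_m lo) (kbar_m hi)`.  v22 (D3 form)
and v23 (no Δ's) are SUPERSEDED. -/

/-- **W3-E `stub_effectiveFrameEnergyL` (L), v25 PROPAGATOR form (option (γ) with Δ0/Δ1/Δ2/M1).**  For the coarse propagator `Um` of the renormalised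
tensor `𝔼` along `E.partialSum m` on `[0,1]` (the `IsPropagator` hypothesis of S23‴), strain budget `θ(m+1) ≤ θ₁`, every window `0 ≤ s ≤ s' ≤ 1` of
length `≤ 2·refresh(m+1)`, and `T ∈ {Um s s', (Um s s')†}`:
(i) `‖T y‖² ≤ ‖y‖² − ½ Σ_k min(1, rateLo ‖k‖ (s'−s)) ‖𝓕y(k)‖²`;
(ii-out) `2L' ≤ L ⇒ ‖(1 − P_L)(T y)‖ ≤ e^(−rateLo L' (s'−s)/2) ‖(1 − P_{L'}) y‖ + (e^(−c₃/θ(m+1)) + e^(−(L−L')/(C₂ N_m))) ‖y‖`;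
(ii-in) `2L' ≤ L ⇒ P_L y = 0 ⇒ ‖T y‖ ≤ (e^(−rateLo L' (s'−s)/2) + e^(−c₃/θ(m+1)) + e^(−(L−L')/(C₂ N_m))) ‖y‖` (`P_L = cutLp L`).
v27 (p4 21:08:07Z (4) / k3l 21:08:28Z endorsed): ENGINE-A currency for ONE factor-2 climb — thin geometric bands of ratio `1+w`, `w = max(4eC_Aϑ, 4N_m|m|/L_j)`,
per-rung commutator cost `≤ 1/(4e)` (`sum_norm_sq_latticeCommutator_le`), `J ≈ ln 2/w` rungs, iterated integrals `(0.11)^J/J!` ⇒ `e^(−c₃/ϑ)`; (Hi) needs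
only `tail ≤ ε`: `c₃/θ(m+1) ≥ c₃ s_m/θ₀` and `(Lcap/4)/(C₂N_m) ≥ K s_m³/(4C₂√c)` are super-small against `ε ≥ c(E)·s_m^(−p)` (…TemplateSuperSmall). -/
theorem stub_effectiveFrameEnergyL : ∀ k (W : Literature.Analysis.FluidPDE.LatticeShear.LatticeWord k) (M : ℝ) (hM : 0 < M) (c : ℝ), 0 < c →
    ∀ (Φ : ℝ → Torus.Visc4 (Fin 3) → Torus.Visc4 (Fin 3)) (lo hi β : ℝ), 0 < lo → lo ≤ 1 → 1 ≤ hi → 0 ≤ β →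
      ∃ C₂ : ℝ, 1 ≤ C₂ ∧ ∃ θ₁ > (0:ℝ), ∃ c₃ > (0:ℝ),
        ∀ E : Literature.Analysis.FluidPDE.LatticeShear.LagrangianLatticeCarrier k, E.design = W.stretch M hM → E.gain = c →
          E.LPermissible → E.Regular → (∀ i, E.θ (i + 1) ≤ θ₁) →
        ∀ (m : ℕ),
        ∀ (S : Torus.Visc4 (Fin 3)), Torus.OddSmall (Φ (E.cellVisc (m + 1)) S) β → Torus.NearIso (Φ (E.cellVisc (m + 1)) S) lo hi →
        ∀ Um : ℝ → ℝ → (V2 →L[ℝ] V2),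
          Torus.IsPropagator 1 (E.partialSum m) (E.kbar m • renormStep (Φ (E.cellVisc (m + 1))) (E.gain / E.cellVisc (m + 1) ^ 2) S) Um →
        ∀ (s s' : ℝ), 0 ≤ s → s ≤ s' → s' ≤ 1 → s' - s ≤ 2 * E.refresh (m + 1) →
        ∀ T : V2 →L[ℝ] V2, (T = Um s s' ∨ T = ContinuousLinearMap.adjoint (Um s s')) →
          -- (i) dissipation floor: the surviving energy loses at least half of the dissipation-weighted spectrum
          (∀ y : V2, ‖T y‖ ^ 2 ≤ ‖y‖ ^ 2 - 1 / 2 * ∑' k' : Fin 3 → ℤ,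
              min 1 (E.a (m + 1) * (8 * Real.pi ^ 2 * ‖Torus.latticeVec k'‖ ^ 2 * lo * (E.cellVisc (m + 1) + c / E.cellVisc (m + 1))
                / (E.N (m + 1) : ℝ) ^ 2) * (s' - s))
              * ‖UnitAddTorus.mFourierCoeff (EuclideanSpace.complexify ∘ ⇑y) k'‖ ^ 2) ∧
          -- (ii-out) band kill, output form (NORM form, factor gap), ENGINE-A currency: one factor-2 climb costs `e^(−c₃/θ(m+1))` (thin geometric
          -- bands, p4 21:08:07Z) and the additive-hop branch `e^(−(L−L')/(C₂ N_m))`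
          (∀ L' L : ℕ, 2 * L' ≤ L → ∀ y : V2,
              ‖T y - cutLp L (T y)‖
                ≤ Real.exp (-(E.a (m + 1) * (8 * Real.pi ^ 2 * (L' : ℝ) ^ 2 * lo * (E.cellVisc (m + 1) + c / E.cellVisc (m + 1))
                    / (E.N (m + 1) : ℝ) ^ 2) * (s' - s) / 2)) * ‖y - cutLp L' y‖
                  + (Real.exp (-(c₃ / E.θ (m + 1))) + Real.exp (-(((L : ℝ) - L') / (C₂ * E.N m)))) * ‖y‖) ∧
          -- (ii-in) band kill, input form (NORM form, factor gap), engine-A currency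
          (∀ L' L : ℕ, 2 * L' ≤ L → ∀ y : V2, cutLp L y = 0 →
              ‖T y‖
                ≤ (Real.exp (-(E.a (m + 1) * (8 * Real.pi ^ 2 * (L' : ℝ) ^ 2 * lo * (E.cellVisc (m + 1) + c / E.cellVisc (m + 1))
                    / (E.N (m + 1) : ℝ) ^ 2) * (s' - s) / 2))
                  + (Real.exp (-(c₃ / E.θ (m + 1))) + Real.exp (-(((L : ℝ) - L') / (C₂ * E.N m))))) * ‖y‖) := by
  sorry

/-! ## §5 (v6) THE ASSEMBLY — S23″ `stub_windowDefectL` (registered text of rev6, block sha16 ead083d60eb13dbb) from the sub-stubs of §1–§4.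
Constants, `m⋆`, the trim level `Lc` with its export (conjunct 1, PROVED: `trimLevel_export` p653589) and `η ≤ 1/8` (conjunct 2, PROVED here) are
discharged; the decomposition core (conjunct 3) is the single remaining `sorry`, with its inputs and steps listed in place.  When it closes, this
theorem lands as `Theorems/…LagrangianStepWindowDefectL.lean --workitem` and the sub-stubs become registered (tenure D24-9/10). -/

theorem windowDefectL_of_subsplit : ∀ k (W : Literature.Analysis.FluidPDE.LatticeShear.LatticeWord k) (M : ℝ) (hM : 0 < M) (c : ℝ), 0 < c →
    ∀ (Φ : ℝ → Torus.Visc4 (Fin 3) → Torus.Visc4 (Fin 3)) (lo hi Λ β σ C ν₀ K Cf νf Kf : ℝ),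
      0 < lo → lo ≤ 1 → 1 ≤ hi → 1 < Λ → 0 ≤ β →
      0 < σ → 0 ≤ C → 0 < ν₀ → 0 < K → SlowVectorClauseF W M hM c Φ lo hi Λ β σ C ν₀ K →
      0 ≤ Cf → 0 < νf → 0 < Kf → CellEnergyClausesW W M hM c lo hi Λ β Cf νf Kf →
      ∃ ν₁ > (0:ℝ), ∃ K₁ > (0:ℝ), ∃ Λ₀ : ℕ, ∃ θ₀ > (0:ℝ), ∃ Cη > (0:ℝ), ∃ ση > (0:ℝ), ∃ Cg > (0:ℝ), ∃ σg > (0:ℝ), ∃ Cτ > (0:ℝ), ∃ στ > (0:ℝ),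
        ∀ E : Literature.Analysis.FluidPDE.LatticeShear.LagrangianLatticeCarrier k, E.design = W.stretch M hM → E.gain = c → E.nu0 ≤ ν₁ → K₁ ≤ E.K →
          E.LPermissible → E.Regular → (∀ m, Λ₀ * E.N m ≤ E.N (m + 1)) → (∀ m, E.N m ^ 2 ≤ E.N (m + 1)) →
          (∀ m, E.cellVisc (m + 1) * ((E.N (m + 1) : ℝ) / E.N m) ^ (1 / 4 : ℝ) ≤ 1) →
          (∀ m, E.K * ((E.N (m + 1) : ℝ) / E.N m) ^ (1 / 4 : ℝ) ≤ ((E.N (m + 1) : ℝ) / E.N m) * E.cellVisc (m + 1)) →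
          (∀ m, E.θ (m + 1) * ((E.N (m + 1) : ℝ) / E.N m) ^ (1 / 16 : ℝ) ≤ θ₀) →
          (∀ m, ((E.N (m + 1) : ℝ) / E.N m) ^ (1 / 16 : ℝ) * E.physPeriod (m + 1) ≤ E.refresh (m + 1)) →
        ∀ R : ℝ≥0, ∃ mstar : ℕ, ∀ m, mstar ≤ m →
          ∃ Lc : ℕ,
          (R : ℝ) ≤ Cτ * ((E.N m : ℝ) / E.N (m + 1)) ^ στ * (Lc : ℝ) ^ 2 * (1 - Real.exp (-(4 * Real.pi ^ 2 * (E.kbar m * lo)))) ∧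
          Cη * ((E.N m : ℝ) / E.N (m + 1)) ^ ση ≤ 1 / 8 ∧
          ∀ S : Torus.Visc4 (Fin 3), Torus.OddSmall S β → Torus.NearIso S lo hi →
            Torus.OddSmall (Φ (E.cellVisc (m + 1)) S) β → Torus.NearIso (Φ (E.cellVisc (m + 1)) S) lo hi →
          ∀ (w₁ : VF) (hw₁ : IsDatum w₁), InClass R w₁ → Torus.fourierTruncate Lc w₁ = w₁ →
          ∀ Um Um1 : ℝ → ℝ → (V2 →L[ℝ] V2),
            Torus.IsPropagator 1 (E.partialSum m) (E.kbar m • renormStep (Φ (E.cellVisc (m + 1))) (E.gain / E.cellVisc (m + 1) ^ 2) S) Um →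
            Torus.IsPropagator 1 (E.partialSum (m + 1)) (E.kbar (m + 1) • S) Um1 →
          ∀ t ∈ Ioo (1/2 : ℝ) 1,
            ∃ (e g : ℕ → V2) (G : ℝ),
              (∀ j, seqL Um1 (datumLp w₁ hw₁) (E.refresh (m + 1)) t (j + 1) =
                  Um (gridL (E.refresh (m + 1)) t j) (gridL (E.refresh (m + 1)) t (j + 1))
                    (seqL Um1 (datumLp w₁ hw₁) (E.refresh (m + 1)) t j) + e j + g j) ∧
              (∀ j (y : V2), |⟪y, e j⟫_ℝ| ≤
                  (Cη * ((E.N m : ℝ) / E.N (m + 1)) ^ ση) *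
                    Real.sqrt (‖seqL Um1 (datumLp w₁ hw₁) (E.refresh (m + 1)) t j‖ ^ 2 -
                      ‖Um (gridL (E.refresh (m + 1)) t j) (gridL (E.refresh (m + 1)) t (j + 1))
                        (seqL Um1 (datumLp w₁ hw₁) (E.refresh (m + 1)) t j)‖ ^ 2) *
                    Real.sqrt (‖y‖ ^ 2 -
                      ‖ContinuousLinearMap.adjoint (Um (gridL (E.refresh (m + 1)) t j) (gridL (E.refresh (m + 1)) t (j + 1))) y‖ ^ 2)) ∧
              0 ≤ G ∧ (∀ K', ∑ j ∈ Finset.range K', ‖g j‖ ≤ G) ∧ G ≤ ‖datumLp w₁ hw₁‖ ∧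
              ‖datumLp w₁ hw₁‖ * G ≤
                Cg * ((E.N m : ℝ) / E.N (m + 1)) ^ σg * (‖datumLp w₁ hw₁‖ ^ 2 - ‖Um 0 t (datumLp w₁ hw₁)‖ ^ 2) := by
  intro k W M hM c hc Φ lo hi Λ β σ C ν₀ K Cf νf Kf hlo hlo1 hhi hΛ hβ hσ hC hν₀ hK hV hCf hνf hKf hCE
  -- constants: ν₁ := min ν₀ νf (S2′ + companions), K₁ := K (the CLAUSE's Bloch constant, so that `K ≤ E.K` puts the tracked range
  -- `Lg·⌈K/ν⌉ ≤ Lg·⌈E.K/ν⌉ ≤ N(m+1)` (`Lg_mul_ceil_le_N`, …Exponents p656189) inside (V)'s validity range), Λ₀ := 2, θ₀ := 1,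
  -- Cη := 1, ση := min (1/128) (σ/200): the TRACKED range is |ℓ| ≤ Lg := ⌊ρ^{1/96}·N(m+1)·cellVisc(m+1)/√c⌋ (well ABOVE the datum's band limit
  -- Lc = ⌊ρ^{1/64}·…⌋ — self-review 18:1xZ: the leftover cut must sit a diverging factor above the datum cut, else the first reset charges the datum's
  -- own near-Lc content as an amplitude-level leftover), on which x_ℓ ≤ ρ^{1/48} ≤ η²/C and the (V) rate error C(ν^σ + (K·ρ^{1/96}/√c)^σ) ≤ η/C for
  -- m ≥ m⋆ (needs ση < σ/96 and 2ση < 1/48); slow modes with d_ℓ < 1 need η² ≥ (C/(8π²·M·W.period))·ρ^{1/16}.  Cg := 1, σg := 1/64, Cτ := 1, στ := 1/16.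
  refine ⟨min ν₀ νf, lt_min hν₀ hνf, K, hK, 2, 1, one_pos, 1, one_pos, min (1 / 128) (σ / 200), lt_min (by norm_num) (by positivity),
    1, one_pos, 1 / 64, by norm_num, 1, one_pos, 1 / 16, by norm_num, ?_⟩
  intro E hdesign hgain hnu0 hK1 hL hR hT1 hT1' hT2 hT3 hT4 hT5 R
  -- conjunct 1 (trim export) and conjunct 2 (η ≤ 1/8) fix m⋆ together with the (finitely many) largeness conditions of the core
  obtain ⟨m₁, hm₁⟩ := trimLevel_export E hdesign hc hgain hL one_pos hT4 hT5 hT3 hT1' hlo (R : ℝ)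
  obtain ⟨m₂, hm₂⟩ := exists_nat_le_two_pow_rpow (e := min (1 / 128) (σ / 200)) (lt_min (by norm_num) (by positivity)) (8 : ℝ)
  -- the tracked range `|ℓ| ≤ Lg` lies inside (V)'s validity range for `m ≥ m₃` (uses `K ≤ E.K`)
  obtain ⟨m₃, hm₃⟩ := Lg_mul_ceil_le_N E.toFractalCarrierData hL.1 hT1' hc
  refine ⟨max m₁ (max m₂ m₃), fun m hm => ?_⟩
  have hm2 : m₂ ≤ m := le_trans ((le_max_left _ _).trans (le_max_right _ _)) hm
  have hm3 : m₃ ≤ m := le_trans ((le_max_right _ _).trans (le_max_right _ _)) hm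
  have hLgE : (⌊((E.N m : ℝ) / E.N (m + 1)) ^ (1 / 96 : ℝ) * ((E.N (m + 1) : ℝ) * E.cellVisc (m + 1)) / Real.sqrt c⌋₊ : ℝ)
      * (⌈E.K / E.cellVisc (m + 1)⌉₊ : ℝ) ≤ E.N (m + 1) := hm₃ m hm3
  obtain ⟨Lc, hLc_le, hexport⟩ := hm₁ m (le_trans (le_max_left _ _) hm)
  refine ⟨Lc, by simpa using hexport, ?_, ?_⟩
  · -- `1 · ρ^{ση} ≤ 1/8` for `m ≥ m₂`: `ρ ≤ 2^{−m}` (rho_le_half_pow) and `(2^m)^{ση} ≥ 8`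
    have hσe : 0 < min (1 / 128 : ℝ) (σ / 200) := lt_min (by norm_num) (by positivity)
    have hρ := rho_le_half_pow E.toFractalCarrierData hL.1 hT1' m
    have hρ0 : 0 ≤ (E.N m : ℝ) / E.N (m + 1) := by have := E.N_pos m; have := E.N_pos (m + 1); positivity
    have h8 : (8 : ℝ) ≤ ((2 : ℝ) ^ m) ^ (min (1 / 128 : ℝ) (σ / 200)) := hm₂ m hm2
    have h1 : ((E.N m : ℝ) / E.N (m + 1)) ^ (min (1 / 128 : ℝ) (σ / 200)) ≤ ((1 / 2 : ℝ) ^ m) ^ (min (1 / 128 : ℝ) (σ / 200)) :=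
      Real.rpow_le_rpow hρ0 hρ hσe.le
    have h2 : ((1 / 2 : ℝ) ^ m) ^ (min (1 / 128 : ℝ) (σ / 200)) = (((2 : ℝ) ^ m) ^ (min (1 / 128 : ℝ) (σ / 200)))⁻¹ := by
      rw [one_div_pow, one_div, Real.inv_rpow (by positivity)]
    have h3 : (((2 : ℝ) ^ m) ^ (min (1 / 128 : ℝ) (σ / 200)))⁻¹ ≤ (8 : ℝ)⁻¹ := inv_anti₀ (by norm_num) h8
    have h4 : ((E.N m : ℝ) / E.N (m + 1)) ^ (min (1 / 128 : ℝ) (σ / 200)) ≤ (8 : ℝ)⁻¹ := h1.trans (h2.le.trans h3)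
    norm_num at h4 ⊢
    linarith
  · -- THE CORE (S3′): for the window shape `S`, the band-limited class-`R` datum `w₁`, the two propagators and `t`, produce `e g G`.
    intro S hS hNI hSΦ hNIΦ w₁ hw₁ hR₁ hband Um Um1 hUm hUm1 t ht
    -- notation: refresh `r`, trimmed datum `x₁`, window times `w j := gridL r t j`, states `u j := seqL Um1 x₁ r t j = U¹(0, w j) x₁`
    have hrpos : 0 < E.refresh (m + 1) := E.refresh_pos (m + 1)
    have ht0 : 0 ≤ t := by linarith [ht.1]
    have ht1 : t ≤ 1 := ht.2.le
    have hw0 : ∀ j, 0 ≤ gridL (E.refresh (m + 1)) t j := fun j => gridL_nonneg hrpos.le ht0 j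
    have hwt : ∀ j, gridL (E.refresh (m + 1)) t j ≤ t := fun j => gridL_le hrpos.le ht0 j
    have hw1 : ∀ j, gridL (E.refresh (m + 1)) t j ≤ 1 := fun j => (hwt j).trans ht1
    have hwmono : ∀ j, gridL (E.refresh (m + 1)) t j ≤ gridL (E.refresh (m + 1)) t (j + 1) :=
      fun j => gridL_mono hrpos.le ht0 j
    have hx₁div : Torus.IsWeaklyDivFree ((datumLp w₁ hw₁ : V2) : VF) := isWeaklyDivFree_datumLp w₁ hw₁
    have hu : ∀ j, seqL Um1 (datumLp w₁ hw₁) (E.refresh (m + 1)) t j = Um1 0 (gridL (E.refresh (m + 1)) t j) (datumLp w₁ hw₁) := by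
      intro j
      cases j with
      | zero => rw [seqL_zero, gridL_zero, hUm1.self_of_divFree 0 le_rfl zero_le_one _ hx₁div]
      | succ j => rw [seqL_succ]
    -- degenerate windows (from index ⌊t/r⌋₊ + 1 on, all window times equal `t`)
    have hwtop : ∀ j, ⌊t / E.refresh (m + 1)⌋₊ + 1 ≤ j → gridL (E.refresh (m + 1)) t j = t := by
      intro j hj
      induction j with
      | zero => exact absurd hj (by omega)
      | succ i ih =>
        rcases Nat.eq_or_lt_of_le hj with h | h
        · rw [← h]; exact gridL_floor_succ hrpos
        · have := ih (by omega)
          have h2 := hwmono i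
          rw [this] at h2
          exact le_antisymm (hwt (i + 1)) h2
    -- (A)/(B) THE DECOMPOSITION (uncut ledger F-lead-7): split the window error BY THE DATUM at the window's start (linearity):
    -- `Lg` = the LEFTOVER cut (tracked range top), a diverging factor ρ^{−(1/64−1/96)} above the datum cut `Lc`;
    -- `Pm` = the mid/junk band projector (physical Fourier modes `Lg < |k| ≤ N(m+1)/2`; frame = physical at a window start),
    -- `g j` := window error generated by the mid-band content of `u j` (leftover: super-small by confinement, since anything above `Lg` has climbed
    --          from `≤ Lc` through ≳ ln(Lg/Lc)/(4ε_w) reset steps — `profile_le` with `P 0 (i+1) = 0`),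
    -- `e j` := window error generated by the rest (slow modes `≤ Lg` + fast content: dissipation-dominated).
    let Lg : ℕ := ⌊((E.N m : ℝ) / E.N (m + 1)) ^ (1 / 96 : ℝ) * ((E.N (m + 1) : ℝ) * E.cellVisc (m + 1)) / Real.sqrt c⌋₊
    let Pm : V2 → V2 := fun y => cutLp (E.N (m + 1) / 2) y - cutLp Lg y
    let U1 : ℕ → (V2 →L[ℝ] V2) := fun j => Um1 (gridL (E.refresh (m + 1)) t j) (gridL (E.refresh (m + 1)) t (j + 1))
    let T : ℕ → (V2 →L[ℝ] V2) := fun j => Um (gridL (E.refresh (m + 1)) t j) (gridL (E.refresh (m + 1)) t (j + 1))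
    let u : ℕ → V2 := fun j => seqL Um1 (datumLp w₁ hw₁) (E.refresh (m + 1)) t j
    let g : ℕ → V2 := fun j =>
      if gridL (E.refresh (m + 1)) t j = gridL (E.refresh (m + 1)) t (j + 1) then 0 else U1 j (Pm (u j)) - T j (Pm (u j))
    let e : ℕ → V2 := fun j =>
      if gridL (E.refresh (m + 1)) t j = gridL (E.refresh (m + 1)) t (j + 1) then 0 else U1 j (u j - Pm (u j)) - T j (u j - Pm (u j))
    refine ⟨e, g, ∑ j ∈ Finset.range (⌊t / E.refresh (m + 1)⌋₊ + 1), ‖g j‖, ?_, ?_, ?_, ?_, ?_, ?_⟩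
    · -- (i) the recursion `u (j+1) = T_j u_j + e_j + g_j`
      intro j
      show u (j + 1) = T j (u j) + e j + g j
      by_cases hdeg : gridL (E.refresh (m + 1)) t j = gridL (E.refresh (m + 1)) t (j + 1)
      · -- degenerate window: `u (j+1) = u j` and `T_j u_j = u_j` (div-free state, `Um s s = id` on div-free)
        have he0 : e j = 0 := if_pos hdeg
        have hg0 : g j = 0 := if_pos hdeg
        have huj : u (j + 1) = u j := by show seqL _ _ _ _ (j + 1) = seqL _ _ _ _ j; rw [hu, hu, ← hdeg]
        have hT : T j (u j) = u j := by
          show Um _ _ (seqL _ _ _ _ j) = seqL _ _ _ _ j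
          rw [← hdeg, hu]
          exact hUm.self_of_divFree _ (hw0 j) (hw1 j) _ (hUm1.divFree _ _ _)
        rw [he0, hg0, add_zero, add_zero, hT, huj]
      · have he : e j = U1 j (u j - Pm (u j)) - T j (u j - Pm (u j)) := if_neg hdeg
        have hg : g j = U1 j (Pm (u j)) - T j (Pm (u j)) := if_neg hdeg
        have hcomp : U1 j (u j) = u (j + 1) := by
          show Um1 _ _ (seqL _ _ _ _ j) = seqL _ _ _ _ (j + 1)
          rw [hu, hu]
          exact hUm1.comp 0 _ _ le_rfl (hw0 j) (hwmono j) (hw1 (j + 1)) _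
        rw [he, hg, ← hcomp]
        simp only [map_sub]
        abel
    · -- (DD) for `e j` against `T j` and its adjoint — S3′ step (C): (V_G)/(X_G)/(C_G)/(F_G) + floors + `dd_assembly`.  OPEN.
      sorry
    · exact Finset.sum_nonneg fun j _ => norm_nonneg _
    · -- partial sums: `g j = 0` from the first degenerate window on
      intro K'
      have hzero : ∀ j, ⌊t / E.refresh (m + 1)⌋₊ + 1 ≤ j → g j = 0 := fun j hj =>
        if_pos (by rw [hwtop j hj, hwtop (j + 1) (by omega)])
      calc ∑ j ∈ Finset.range K', ‖g j‖
          = ∑ j ∈ Finset.range K' ∩ Finset.range (⌊t / E.refresh (m + 1)⌋₊ + 1), ‖g j‖ := by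
            refine (Finset.sum_subset Finset.inter_subset_left (fun j hj hj' => ?_)).symm
            have hge : ⌊t / E.refresh (m + 1)⌋₊ + 1 ≤ j := by
              by_contra hlt
              exact hj' (Finset.mem_inter.2 ⟨hj, Finset.mem_range.2 (by omega)⟩)
            rw [hzero j hge, norm_zero]
        _ ≤ ∑ j ∈ Finset.range (⌊t / E.refresh (m + 1)⌋₊ + 1), ‖g j‖ :=
            Finset.sum_le_sum_of_subset_of_nonneg Finset.inter_subset_right (fun j _ _ => norm_nonneg _)
    · -- `G ≤ ‖x₁‖`, from `‖g j‖ ≤ 2‖Pm (u j)‖` (contractions) and the CONFINEMENT input `hconf` below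
      have hg_le : ∀ j, ‖g j‖ ≤ 2 * ‖Pm (u j)‖ := by
        intro j
        by_cases hdeg : gridL (E.refresh (m + 1)) t j = gridL (E.refresh (m + 1)) t (j + 1)
        · have : g j = 0 := if_pos hdeg
          rw [this, norm_zero]; positivity
        · have : g j = U1 j (Pm (u j)) - T j (Pm (u j)) := if_neg hdeg
          rw [this]
          calc ‖U1 j (Pm (u j)) - T j (Pm (u j))‖ ≤ ‖U1 j (Pm (u j))‖ + ‖T j (Pm (u j))‖ := norm_sub_le _ _
            _ ≤ ‖Pm (u j)‖ + ‖Pm (u j)‖ := add_le_add (hUm1.norm_le _ _ _) (hUm.norm_le _ _ _)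
            _ = 2 * ‖Pm (u j)‖ := by ring
      -- CONFINEMENT (the one analytic input of the leftover side; S3′ step (D): `profile_top_le` fed by (B_G) per window and S3e′ per reset,
      -- datum band-limited at Lc ≪ Lg so `P 0 (i+1) = 0`): the mid-band content of the states is super-small, in the two normalisations used below.
      have hconf : ∑ j ∈ Finset.range (⌊t / E.refresh (m + 1)⌋₊ + 1), ‖Pm (u j)‖ ≤ ‖datumLp w₁ hw₁‖ / 2 := by
        sorry
      calc ∑ j ∈ Finset.range (⌊t / E.refresh (m + 1)⌋₊ + 1), ‖g j‖
          ≤ ∑ j ∈ Finset.range (⌊t / E.refresh (m + 1)⌋₊ + 1), 2 * ‖Pm (u j)‖ := Finset.sum_le_sum fun j _ => hg_le j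
        _ = 2 * ∑ j ∈ Finset.range (⌊t / E.refresh (m + 1)⌋₊ + 1), ‖Pm (u j)‖ := by rw [Finset.mul_sum]
        _ ≤ 2 * (‖datumLp w₁ hw₁‖ / 2) := mul_le_mul_of_nonneg_left hconf (by norm_num)
        _ = ‖datumLp w₁ hw₁‖ := by ring
    · -- the leftover budget `‖x₁‖·G ≤ ρ^{1/64}·(‖x₁‖² − ‖Um 0 t x₁‖²)`, from the same two facts in the drop normalisation
      have hg_le : ∀ j, ‖g j‖ ≤ 2 * ‖Pm (u j)‖ := by
        intro j
        by_cases hdeg : gridL (E.refresh (m + 1)) t j = gridL (E.refresh (m + 1)) t (j + 1)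
        · have : g j = 0 := if_pos hdeg
          rw [this, norm_zero]; positivity
        · have : g j = U1 j (Pm (u j)) - T j (Pm (u j)) := if_neg hdeg
          rw [this]
          calc ‖U1 j (Pm (u j)) - T j (Pm (u j))‖ ≤ ‖U1 j (Pm (u j))‖ + ‖T j (Pm (u j))‖ := norm_sub_le _ _
            _ ≤ ‖Pm (u j)‖ + ‖Pm (u j)‖ := add_le_add (hUm1.norm_le _ _ _) (hUm.norm_le _ _ _)
            _ = 2 * ‖Pm (u j)‖ := by ring
      have hdrop : 0 ≤ ‖datumLp w₁ hw₁‖ ^ 2 - ‖Um 0 t (datumLp w₁ hw₁)‖ ^ 2 :=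
        sub_nonneg.2 (pow_le_pow_left₀ (norm_nonneg _) (hUm.norm_le _ _ _) 2)
      -- CONFINEMENT, drop normalisation (same input as above; the comparison «super-polynomially small ≤ ρ^{1/64}·baseT-scale drop» lives here)
      have hconf' : (‖datumLp w₁ hw₁‖ + 1) * ∑ j ∈ Finset.range (⌊t / E.refresh (m + 1)⌋₊ + 1), ‖Pm (u j)‖
          ≤ ((E.N m : ℝ) / E.N (m + 1)) ^ (1 / 64 : ℝ) * (‖datumLp w₁ hw₁‖ ^ 2 - ‖Um 0 t (datumLp w₁ hw₁)‖ ^ 2) / 2 := by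
        sorry
      have hx0 : 0 ≤ ‖datumLp w₁ hw₁‖ := norm_nonneg _
      have hS0 : 0 ≤ ∑ j ∈ Finset.range (⌊t / E.refresh (m + 1)⌋₊ + 1), ‖Pm (u j)‖ := Finset.sum_nonneg fun j _ => norm_nonneg _
      calc ‖datumLp w₁ hw₁‖ * ∑ j ∈ Finset.range (⌊t / E.refresh (m + 1)⌋₊ + 1), ‖g j‖
          ≤ ‖datumLp w₁ hw₁‖ * (2 * ∑ j ∈ Finset.range (⌊t / E.refresh (m + 1)⌋₊ + 1), ‖Pm (u j)‖) := by
            refine mul_le_mul_of_nonneg_left ?_ hx0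
            rw [Finset.mul_sum]; exact Finset.sum_le_sum fun j _ => hg_le j
        _ ≤ 2 * ((‖datumLp w₁ hw₁‖ + 1) * ∑ j ∈ Finset.range (⌊t / E.refresh (m + 1)⌋₊ + 1), ‖Pm (u j)‖) := by nlinarith
        _ ≤ 2 * (((E.N m : ℝ) / E.N (m + 1)) ^ (1 / 64 : ℝ) * (‖datumLp w₁ hw₁‖ ^ 2 - ‖Um 0 t (datumLp w₁ hw₁)‖ ^ 2) / 2) :=
            mul_le_mul_of_nonneg_left hconf' (by norm_num)
        _ = 1 * ((E.N m : ℝ) / E.N (m + 1)) ^ (1 / 64 : ℝ) * (‖datumLp w₁ hw₁‖ ^ 2 - ‖Um 0 t (datumLp w₁ hw₁)‖ ^ 2) := by ring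

/-! ## §6 (v16, tenure D24-23) S23‴ DRAFT — the v4 interface: ENERGY COMPARISON for band-limited data under the extra flat clause `HighLabelDecayW`

`stub_windowDefectL` (S23″, registry v3) is ON HOLD and will be SUPERSEDED (D24-23): its «(DD) ∀ y» clause cannot survive the reset-scrambled corrector
deposits (p4 g12 F-p4g12-4 / lead F-lead-9).  v4 interface (lead's (i), tenure-endorsed): same prefix + the flat high-label decay clause as HYPOTHESIS,
conclusion = the energy comparison for the trimmed datum with abstract propagators; the flat clause is the LANDED `HighLabelDecayW`
(`…OneLevelSplitDefsH`, p659807, text p4 g12 dcdcc2afc20b). -/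

/-- **S23‴ `windowDefectH_text` = TEXT OF RECORD in the Kb-FIX form (tenure D25-1: p4 g12 `Lines/onelevel_S23H_Kbfix.lean` l.47–74, block sha16
67be95a17dc9ee1d, theorem `windowDefectH_textKb`; the stub receives the whole `∀ Kb ≥ 1` family = W7's output shape and picks `Kb ≥ K/c_V` itself;
`HighLabelDecayW` = landed DefsH p659807 4d049a52091b)**: under the S23″ prefix PLUS `HighLabelDecayW`, for `m ≥ m⋆(R,E)` the stub chooses
the trim level `Lc` (with the export of TrimLevel) and, for every band-limited class-`R` datum and every pair of abstract propagators, the level-`(m+1)`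
energy at time `t ∈ (1/2,1)` is at most the level-`m` energy plus `Cη ρ^ση ×` the level-`m` drop.  (Text of record proposed by the lead for registry v4; the registered stub copies the signature byte-for-byte.) -/
theorem windowDefectH_text : ∀ k (W : Literature.Analysis.FluidPDE.LatticeShear.LatticeWord k) (M : ℝ) (hM : 0 < M) (c : ℝ), 0 < c →
    ∀ (Φ : ℝ → Torus.Visc4 (Fin 3) → Torus.Visc4 (Fin 3)) (lo hi Λ β σ C ν₀ K Cf νf Kf : ℝ),
      0 < lo → lo ≤ 1 → 1 ≤ hi → 1 < Λ → 0 ≤ β →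
      0 < σ → 0 ≤ C → 0 < ν₀ → 0 < K → SlowVectorClauseF W M hM c Φ lo hi Λ β σ C ν₀ K →
      0 ≤ Cf → 0 < νf → 0 < Kf → CellEnergyClausesW W M hM c lo hi Λ β Cf νf Kf →
      (∀ Kb : ℝ, 1 ≤ Kb → ∃ CK : ℝ, 1 ≤ CK ∧ ∃ cK > (0:ℝ), ∃ νh > (0:ℝ), HighLabelDecayW W M hM lo hi Λ β νh Kb CK cK) →
      ∃ ν₁ > (0:ℝ), ∃ K₁ > (0:ℝ), ∃ Λ₀ : ℕ, ∃ θ₀ > (0:ℝ), ∃ Cη > (0:ℝ), ∃ ση > (0:ℝ), ∃ Cτ > (0:ℝ), ∃ στ > (0:ℝ),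
        ∀ E : Literature.Analysis.FluidPDE.LatticeShear.LagrangianLatticeCarrier k, E.design = W.stretch M hM → E.gain = c → E.nu0 ≤ ν₁ → K₁ ≤ E.K →
          E.LPermissible → E.Regular → (∀ m, Λ₀ * E.N m ≤ E.N (m + 1)) → (∀ m, E.N m ^ 2 ≤ E.N (m + 1)) →
          (∀ m, E.cellVisc (m + 1) * ((E.N (m + 1) : ℝ) / E.N m) ^ (1 / 4 : ℝ) ≤ 1) →
          (∀ m, E.K * ((E.N (m + 1) : ℝ) / E.N m) ^ (1 / 4 : ℝ) ≤ ((E.N (m + 1) : ℝ) / E.N m) * E.cellVisc (m + 1)) →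
          (∀ m, E.θ (m + 1) * ((E.N (m + 1) : ℝ) / E.N m) ^ (1 / 16 : ℝ) ≤ θ₀) →
          (∀ m, ((E.N (m + 1) : ℝ) / E.N m) ^ (1 / 16 : ℝ) * E.physPeriod (m + 1) ≤ E.refresh (m + 1)) →
        ∀ R : ℝ≥0, ∃ mstar : ℕ, ∀ m, mstar ≤ m →
          ∃ Lc : ℕ,
          (R : ℝ) ≤ Cτ * ((E.N m : ℝ) / E.N (m + 1)) ^ στ * (Lc : ℝ) ^ 2 * (1 - Real.exp (-(4 * Real.pi ^ 2 * (E.kbar m * lo)))) ∧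
          Cη * ((E.N m : ℝ) / E.N (m + 1)) ^ ση ≤ 1 / 8 ∧
          ∀ S : Torus.Visc4 (Fin 3), Torus.OddSmall S β → Torus.NearIso S lo hi →
            Torus.OddSmall (Φ (E.cellVisc (m + 1)) S) β → Torus.NearIso (Φ (E.cellVisc (m + 1)) S) lo hi →
          ∀ (w₁ : VF) (hw₁ : IsDatum w₁), InClass R w₁ → Torus.fourierTruncate Lc w₁ = w₁ →
          ∀ Um Um1 : ℝ → ℝ → (V2 →L[ℝ] V2),
            Torus.IsPropagator 1 (E.partialSum m) (E.kbar m • renormStep (Φ (E.cellVisc (m + 1))) (E.gain / E.cellVisc (m + 1) ^ 2) S) Um →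
            Torus.IsPropagator 1 (E.partialSum (m + 1)) (E.kbar (m + 1) • S) Um1 →
          ∀ t ∈ Ioo (1/2 : ℝ) 1,
            ‖Um1 0 t (datumLp w₁ hw₁)‖ ^ 2
              ≤ ‖Um 0 t (datumLp w₁ hw₁)‖ ^ 2
                + Cη * ((E.N m : ℝ) / E.N (m + 1)) ^ ση * (‖datumLp w₁ hw₁‖ ^ 2 - ‖Um 0 t (datumLp w₁ hw₁)‖ ^ 2) := by
  sorry

/-! ## §7 (v20) The Hilbert-space brick of the v4 assembly is LANDED: `window_ledger_split` (`…Theorems…LagrangianStepLedgerSplit`, p661019)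

`theorem window_ledger_split (T : ℕ → V →L[ℝ] V) (hT : ∀ k x, ‖T k x‖ ≤ ‖x‖) (u v e f : ℕ → V) (η η' : ℝ) (F c s : ℕ → ℝ)
  (hη : 0 ≤ η) (hη8 : η ≤ 1/8) (hη' : 0 ≤ η') (hη'8 : η' ≤ 1/8) (hs : ∀ k, 0 ≤ s k) (h0 : u 0 = v 0) (hv : ∀ k, v (k+1) = T k (v k))
  (hu : ∀ k, u (k+1) = T k (u k) + e k + f k) (huB : ∀ k, ‖u k‖ ≤ ‖u 0‖) (hDD : (DD) for e against every y)
  (hF1 : ∀ k, ‖f k‖² ≤ F k) (hF2 : ∀ k, ‖T (k+1) (f k)‖ ≤ s k) (hF3 : ∀ k, ‖(T k)† (f k)‖ ≤ s k) (hF4 : ∀ k, |⟪e k, f k⟫| ≤ c k)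
  (hbudget : ∀ K, Σ_{k<K} (F k + 2 c k) ≤ η'·Σ_{k<K} 𝔇_k(u k)) (K : ℕ) :
  ‖u K‖² ≤ ‖v K‖² + 4(η + η')·(‖v 0‖² − ‖v K‖²) + 10·(Σ_{k<K} s k)·‖v 0‖`
— the label-split window ledger (u = true chain of the trimmed datum on the gridL windows, v = coarse chain, e k = (U¹−Uᵐ) z_k with z_k the content on
labels ≤ Lg (slow + fast members; (DD) by dd_assembly_op + floors incl. fresh corrector deposits), f k = (U¹−Uᵐ) h_k the evolved OLD high-label content
(energy F k from `energy_recursion_le` + (M♭_G); s k super-small by (H_G)/(E_G⁺); c k = √ε_k·φ‖h_k‖)).  The S23‴ assembly §8 (successor) instantiates it. -/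


/-! ## §8 (v22, lead g3) THE OPERATOR-LEVEL CUT — S23‴ is DISCHARGED by the LANDED glue `windowDefectH_of_windowFacts` (…WindowDefectHGlue p665050,
over …LedgerSplitSlopWindow p663286 / …LedgerSplitSlop p664182 / …LedgerTransfer p664495 / …LedgerGrid p664651) from the «window facts» below
(= `stub_windowFactsH` of the registry v6 CANDIDATE `Lines/onelevel_v6_candidate.lean`; memo `Lines/onelevel-L5-operator-glue.md`).  The sub-stubs of
§1–§4c feed the three operator facts: (Z) ← (V_G) §2 (per-mode DIFFERENCE û − v̂) + companions §4 (C_G⁺)(F_G⁺)(X_G⁺) + W3-E §4c (i) floors via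
`dd_assembly_op`; (Hi) ← §4c (ii) (E_G⁺) + S3e⁺; (Rec) ← in-range contraction (B_G^c) ⊕ (M♭_G) from (H) + deposits/climbs; the projectors ← W0
(Bloch-label projectors on `V2`).  The text is stated with `ContinuousLinearMap.adjoint` written out (registry context opens nothing). -/

/-- **`windowFactsH_text` — the operator-level window facts (lead g3; text of `stub_windowFactsH` in the v6 candidate, byte-for-byte).**  See §8 header
and `Lines/onelevel-L5-operator-glue.md` §3–§4 (review asks R1–R3).  `windowDefectH_of_windowFactsPinned windowFactsH_text` is the registered S23‴ text (v24: `Lc` PINNED at the trim cap — for small `Lc` (Hi) over-asks). -/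
theorem windowFactsH_text : ∀ k (W : Literature.Analysis.FluidPDE.LatticeShear.LatticeWord k) (M : ℝ) (hM : 0 < M) (c : ℝ), 0 < c →
    ∀ (Φ : ℝ → Torus.Visc4 (Fin 3) → Torus.Visc4 (Fin 3)) (lo hi Λ β σ C ν₀ K Cf νf Kf : ℝ),
      0 < lo → lo ≤ 1 → 1 ≤ hi → 1 < Λ → 0 ≤ β →
      0 < σ → 0 ≤ C → 0 < ν₀ → 0 < K → SlowVectorClauseF W M hM c Φ lo hi Λ β σ C ν₀ K →
      0 ≤ Cf → 0 < νf → 0 < Kf → CellEnergyClausesW W M hM c lo hi Λ β Cf νf Kf →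
      (∀ Kb : ℝ, 1 ≤ Kb → ∃ CK : ℝ, 1 ≤ CK ∧ ∃ cK > (0:ℝ), ∃ νh > (0:ℝ), HighLabelDecayW W M hM lo hi Λ β νh Kb CK cK) →
      ∃ ν₁ > (0:ℝ), ∃ K₁ > (0:ℝ), ∃ Λ₀ : ℕ, ∃ θ₀ > (0:ℝ), ∃ Cw > (0:ℝ), ∃ σw > (0:ℝ),
        ∀ E : Literature.Analysis.FluidPDE.LatticeShear.LagrangianLatticeCarrier k, E.design = W.stretch M hM → E.gain = c → E.nu0 ≤ ν₁ → K₁ ≤ E.K →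
          E.LPermissible → E.Regular → (∀ m, Λ₀ * E.N m ≤ E.N (m + 1)) → (∀ m, E.N m ^ 2 ≤ E.N (m + 1)) →
          (∀ m, E.cellVisc (m + 1) * ((E.N (m + 1) : ℝ) / E.N m) ^ (1 / 4 : ℝ) ≤ 1) →
          (∀ m, E.K * ((E.N (m + 1) : ℝ) / E.N m) ^ (1 / 4 : ℝ) ≤ ((E.N (m + 1) : ℝ) / E.N m) * E.cellVisc (m + 1)) →
          (∀ m, E.θ (m + 1) * ((E.N (m + 1) : ℝ) / E.N m) ^ (1 / 16 : ℝ) ≤ θ₀) →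
          (∀ m, ((E.N (m + 1) : ℝ) / E.N m) ^ (1 / 16 : ℝ) * E.physPeriod (m + 1) ≤ E.refresh (m + 1)) →
        ∃ mstar : ℕ, ∀ m, mstar ≤ m →
          E.refresh (m + 1) ≤ 1 / 4 ∧
          ∀ Lc : ℕ, Lc = ⌊((E.N m : ℝ) / E.N (m + 1)) ^ (1 / 64 : ℝ) * (E.N (m + 1) * E.cellVisc (m + 1)) / Real.sqrt c⌋₊ →
          ∀ S : Torus.Visc4 (Fin 3), Torus.OddSmall S β → Torus.NearIso S lo hi →
            Torus.OddSmall (Φ (E.cellVisc (m + 1)) S) β → Torus.NearIso (Φ (E.cellVisc (m + 1)) S) lo hi →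
          ∀ Um Um1 : ℝ → ℝ → (V2 →L[ℝ] V2),
            Torus.IsPropagator 1 (E.partialSum m) (E.kbar m • renormStep (Φ (E.cellVisc (m + 1))) (E.gain / E.cellVisc (m + 1) ^ 2) S) Um →
            Torus.IsPropagator 1 (E.partialSum (m + 1)) (E.kbar (m + 1) • S) Um1 →
          ∀ ηm ε : ℝ, ηm = Cw * ((E.N m : ℝ) / E.N (m + 1)) ^ σw →
            ε = ((E.N m : ℝ) / E.N (m + 1)) ^ σw * (1 - Real.exp (-(4 * Real.pi ^ 2 * (E.kbar m * lo)))) * E.refresh (m + 1) →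
          ∃ P Q₁ Q₂ : V2 →L[ℝ] V2,
            (∀ y : V2, P y + Q₁ y + Q₂ y = y) ∧ (∀ y : V2, ‖y‖ ^ 2 = ‖P y‖ ^ 2 + ‖Q₁ y‖ ^ 2 + ‖Q₂ y‖ ^ 2) ∧
            (∀ y y' : V2, ⟪P y, Q₁ y' + Q₂ y'⟫_ℝ = 0) ∧
          ∀ (w₁ : VF) (hw₁ : IsDatum w₁), Torus.fourierTruncate Lc w₁ = w₁ →
            Q₂ (datumLp w₁ hw₁) = 0 ∧
            ∀ (j : ℕ) (s' : ℝ), (j : ℝ) * E.refresh (m + 1) + E.refresh (m + 1) ≤ s' →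
              s' ≤ (j : ℝ) * E.refresh (m + 1) + 2 * E.refresh (m + 1) → s' ≤ 1 →
            (∀ y : V2, |⟪y, P (Um1 ((j : ℝ) * E.refresh (m + 1)) s' (Um1 0 ((j : ℝ) * E.refresh (m + 1)) (datumLp w₁ hw₁)) - Um ((j : ℝ) * E.refresh (m + 1)) s' (Um1 0 ((j : ℝ) * E.refresh (m + 1)) (datumLp w₁ hw₁)))⟫_ℝ| ≤
                ηm * Real.sqrt (‖Um1 0 ((j : ℝ) * E.refresh (m + 1)) (datumLp w₁ hw₁)‖ ^ 2 - ‖Um ((j : ℝ) * E.refresh (m + 1)) s' (Um1 0 ((j : ℝ) * E.refresh (m + 1)) (datumLp w₁ hw₁))‖ ^ 2) * Real.sqrt (‖y‖ ^ 2 - ‖ContinuousLinearMap.adjoint (Um ((j : ℝ) * E.refresh (m + 1)) s') y‖ ^ 2) + ε * ‖datumLp w₁ hw₁‖ * ‖y‖) ∧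
            (∀ y : V2, ‖Um ((j : ℝ) * E.refresh (m + 1)) s' (Q₁ y + Q₂ y)‖ ≤ ε * ‖y‖ ∧ ‖Q₁ (Um ((j : ℝ) * E.refresh (m + 1)) s' y) + Q₂ (Um ((j : ℝ) * E.refresh (m + 1)) s' y)‖ ≤ ε * ‖y‖ ∧
                ‖ContinuousLinearMap.adjoint (Um ((j : ℝ) * E.refresh (m + 1)) s') (Q₁ y + Q₂ y)‖ ≤ ε * ‖y‖) ∧
            ‖Q₁ (Um1 ((j : ℝ) * E.refresh (m + 1)) s' (P (Um1 0 ((j : ℝ) * E.refresh (m + 1)) (datumLp w₁ hw₁))))‖ ≤ Real.sqrt (ηm * (‖Um1 0 ((j : ℝ) * E.refresh (m + 1)) (datumLp w₁ hw₁)‖ ^ 2 - ‖Um ((j : ℝ) * E.refresh (m + 1)) s' (Um1 0 ((j : ℝ) * E.refresh (m + 1)) (datumLp w₁ hw₁))‖ ^ 2)) + ε * ‖datumLp w₁ hw₁‖ ∧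
            ‖Q₂ (Um1 ((j : ℝ) * E.refresh (m + 1)) s' (P (Um1 0 ((j : ℝ) * E.refresh (m + 1)) (datumLp w₁ hw₁))))‖ ≤ Real.sqrt (ηm * (‖Um1 0 ((j : ℝ) * E.refresh (m + 1)) (datumLp w₁ hw₁)‖ ^ 2 - ‖Um ((j : ℝ) * E.refresh (m + 1)) s' (Um1 0 ((j : ℝ) * E.refresh (m + 1)) (datumLp w₁ hw₁))‖ ^ 2)) + ε * ‖datumLp w₁ hw₁‖ ∧
            ‖Q₁ (Um1 ((j : ℝ) * E.refresh (m + 1)) s' (Q₁ (Um1 0 ((j : ℝ) * E.refresh (m + 1)) (datumLp w₁ hw₁))))‖ ≤ ηm * ‖Q₁ (Um1 0 ((j : ℝ) * E.refresh (m + 1)) (datumLp w₁ hw₁))‖ + ε * ‖datumLp w₁ hw₁‖ ∧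
            ‖Q₂ (Um1 ((j : ℝ) * E.refresh (m + 1)) s' (Q₁ (Um1 0 ((j : ℝ) * E.refresh (m + 1)) (datumLp w₁ hw₁))))‖ ≤ ηm * ‖Q₁ (Um1 0 ((j : ℝ) * E.refresh (m + 1)) (datumLp w₁ hw₁))‖ + ε * ‖datumLp w₁ hw₁‖ ∧
            ‖Q₁ (Um1 ((j : ℝ) * E.refresh (m + 1)) s' (Q₂ (Um1 0 ((j : ℝ) * E.refresh (m + 1)) (datumLp w₁ hw₁))))‖ ≤ ηm * ‖Q₂ (Um1 0 ((j : ℝ) * E.refresh (m + 1)) (datumLp w₁ hw₁))‖ + ε * ‖datumLp w₁ hw₁‖ ∧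
            ‖Q₂ (Um1 ((j : ℝ) * E.refresh (m + 1)) s' (Q₂ (Um1 0 ((j : ℝ) * E.refresh (m + 1)) (datumLp w₁ hw₁))))‖ ≤ 1 / 2 * ‖Q₂ (Um1 0 ((j : ℝ) * E.refresh (m + 1)) (datumLp w₁ hw₁))‖ + ε * ‖datumLp w₁ hw₁‖ := by
  sorry


/-! ## §9 (v28, lead g3) THE CELL-SIDE OPERATOR INPUTS of `stub_windowFactsH` — what W4/W5/W6/(X_G⁺)/(M♭_G) must jointly deliver, binder-exact,
in the shapes consumed by the landed consumer-side algebra (`z_of_pieces` p669953, `floor_of_dissipBound`, `hi_of_bandKill` p667802, `hi_tails_le_eps`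
p669781, `exists_labelSplit` p666592, `transfer_ledger` p664495).  The lead's final assembly `windowFactsH_of_inputs : (W3-E §4c text) → (this text) →
stub_windowFactsH` is the next landing (NOTES § NextBig).  The provider CHOOSES the three frequency classes `A, B, C` (intended: label distance
`≤ Lc/2`, `(Lc/2, Lg]`, `> Lg`; only symmetry, partition, and the two frequency inclusions are consumed) and, for the label projectors characterised by
them, delivers per grid window: (Zin) a splitting of the low-label window error into the four V2 pieces of `z_of_pieces` with weights
`d_k = min(1, rateLo‖k‖·τ)` on the slow-low Finset `freqBall (Lc/2) ∖ {0}`, and (Recin) the six transfer bounds.  One small scale `ηz = Cz ρ^σz`, the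
stub's slop `ε`.  Map to producers: L6 memo §2–§3. -/

open scoped Classical in
/-- **`cellInputs_text` (lead g3, split v28 §9).**  See the §9 header. -/
theorem cellInputs_text : ∀ k (W : Literature.Analysis.FluidPDE.LatticeShear.LatticeWord k) (M : ℝ) (hM : 0 < M) (c : ℝ), 0 < c →
    ∀ (Φ : ℝ → Torus.Visc4 (Fin 3) → Torus.Visc4 (Fin 3)) (lo hi Λ β σ C ν₀ K Cf νf Kf : ℝ),
      0 < lo → lo ≤ 1 → 1 ≤ hi → 1 < Λ → 0 ≤ β →
      0 < σ → 0 ≤ C → 0 < ν₀ → 0 < K → SlowVectorClauseF W M hM c Φ lo hi Λ β σ C ν₀ K →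
      0 ≤ Cf → 0 < νf → 0 < Kf → CellEnergyClausesW W M hM c lo hi Λ β Cf νf Kf →
      (∀ Kb : ℝ, 1 ≤ Kb → ∃ CK : ℝ, 1 ≤ CK ∧ ∃ cK > (0:ℝ), ∃ νh > (0:ℝ), HighLabelDecayW W M hM lo hi Λ β νh Kb CK cK) →
      ∃ ν₁ > (0:ℝ), ∃ K₁ > (0:ℝ), ∃ Λ₀ : ℕ, ∃ θ₀ > (0:ℝ), ∃ Cz > (0:ℝ), ∃ σz > (0:ℝ),
        ∀ E : Literature.Analysis.FluidPDE.LatticeShear.LagrangianLatticeCarrier k, E.design = W.stretch M hM → E.gain = c → E.nu0 ≤ ν₁ → K₁ ≤ E.K →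
          E.LPermissible → E.Regular → (∀ m, Λ₀ * E.N m ≤ E.N (m + 1)) → (∀ m, E.N m ^ 2 ≤ E.N (m + 1)) →
          (∀ m, E.cellVisc (m + 1) * ((E.N (m + 1) : ℝ) / E.N m) ^ (1 / 4 : ℝ) ≤ 1) →
          (∀ m, E.K * ((E.N (m + 1) : ℝ) / E.N m) ^ (1 / 4 : ℝ) ≤ ((E.N (m + 1) : ℝ) / E.N m) * E.cellVisc (m + 1)) →
          (∀ m, E.θ (m + 1) * ((E.N (m + 1) : ℝ) / E.N m) ^ (1 / 16 : ℝ) ≤ θ₀) →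
          (∀ m, ((E.N (m + 1) : ℝ) / E.N m) ^ (1 / 16 : ℝ) * E.physPeriod (m + 1) ≤ E.refresh (m + 1)) →
        ∃ mstar : ℕ, ∀ m, mstar ≤ m →
          E.refresh (m + 1) ≤ 1 / 4 ∧
          ∀ Lc : ℕ, Lc = ⌊((E.N m : ℝ) / E.N (m + 1)) ^ (1 / 64 : ℝ) * (E.N (m + 1) * E.cellVisc (m + 1)) / Real.sqrt c⌋₊ →
          ∀ S : Torus.Visc4 (Fin 3), Torus.OddSmall S β → Torus.NearIso S lo hi →
            Torus.OddSmall (Φ (E.cellVisc (m + 1)) S) β → Torus.NearIso (Φ (E.cellVisc (m + 1)) S) lo hi →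
          ∀ Um Um1 : ℝ → ℝ → (V2 →L[ℝ] V2),
            Torus.IsPropagator 1 (E.partialSum m) (E.kbar m • renormStep (Φ (E.cellVisc (m + 1))) (E.gain / E.cellVisc (m + 1) ^ 2) S) Um →
            Torus.IsPropagator 1 (E.partialSum (m + 1)) (E.kbar (m + 1) • S) Um1 →
          ∀ ηz ε : ℝ, ηz = Cz * ((E.N m : ℝ) / E.N (m + 1)) ^ σz →
            ε = ((E.N m : ℝ) / E.N (m + 1)) ^ σz * (1 - Real.exp (-(4 * Real.pi ^ 2 * (E.kbar m * lo)))) * E.refresh (m + 1) →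
          ∃ A B C : Set (Fin 3 → ℤ),
            (∀ k', k' ∈ A ↔ -k' ∈ A) ∧ (∀ k', k' ∈ B ↔ -k' ∈ B) ∧ (∀ k', k' ∈ C ↔ -k' ∈ C) ∧
            (∀ k', k' ∈ A → k' ∉ B) ∧ (∀ k', k' ∈ A → k' ∉ C) ∧ (∀ k', k' ∈ B → k' ∉ C) ∧ (∀ k', k' ∈ A ∨ k' ∈ B ∨ k' ∈ C) ∧
            (∀ k', k' ∈ B ∨ k' ∈ C → (((Lc / 2 : ℕ) : ℝ)) ^ 2 < Torus.freqNormSq k') ∧ (∀ k', k' ∈ C → ((Lc : ℝ)) ^ 2 < Torus.freqNormSq k') ∧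
          ∀ P Q₁ Q₂ : V2 →L[ℝ] V2,
            (∀ (y : V2) (k' : Fin 3 → ℤ), UnitAddTorus.mFourierCoeff (EuclideanSpace.complexify ∘ ⇑(P y)) k' = if k' ∈ A then UnitAddTorus.mFourierCoeff (EuclideanSpace.complexify ∘ ⇑(y)) k' else 0) →
            (∀ (y : V2) (k' : Fin 3 → ℤ), UnitAddTorus.mFourierCoeff (EuclideanSpace.complexify ∘ ⇑(Q₁ y)) k' = if k' ∈ B then UnitAddTorus.mFourierCoeff (EuclideanSpace.complexify ∘ ⇑(y)) k' else 0) →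
            (∀ (y : V2) (k' : Fin 3 → ℤ), UnitAddTorus.mFourierCoeff (EuclideanSpace.complexify ∘ ⇑(Q₂ y)) k' = if k' ∈ C then UnitAddTorus.mFourierCoeff (EuclideanSpace.complexify ∘ ⇑(y)) k' else 0) →
          ∀ (w₁ : VF) (hw₁ : IsDatum w₁), Torus.fourierTruncate Lc w₁ = w₁ →
            ∀ (j : ℕ) (s' : ℝ), (j : ℝ) * E.refresh (m + 1) + E.refresh (m + 1) ≤ s' →
              s' ≤ (j : ℝ) * E.refresh (m + 1) + 2 * E.refresh (m + 1) → s' ≤ 1 →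
              -- (Zin) the low-label window error splits into the four pieces of `z_of_pieces` (diag W6 · cross (X_G⁺) · leak W5 · fast W5⊕(M♭_G))
              (∃ e_d e_c e_l e_f : V2,
                P (Um1 ((j : ℝ) * E.refresh (m + 1)) s' (Um1 0 ((j : ℝ) * E.refresh (m + 1)) (datumLp w₁ hw₁)) - Um ((j : ℝ) * E.refresh (m + 1)) s' (Um1 0 ((j : ℝ) * E.refresh (m + 1)) (datumLp w₁ hw₁))) = e_d + e_c + e_l + e_f ∧
                (∀ k', k' ∉ ((Torus.freqBall (Lc / 2)).erase 0) → UnitAddTorus.mFourierCoeff (EuclideanSpace.complexify ∘ ⇑(e_d)) k' = 0) ∧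
                (∀ k', k' ∉ ((Torus.freqBall (Lc / 2)).erase 0) → UnitAddTorus.mFourierCoeff (EuclideanSpace.complexify ∘ ⇑(e_l)) k' = 0) ∧
                (∀ k', k' ∈ ((Torus.freqBall (Lc / 2)).erase 0) → UnitAddTorus.mFourierCoeff (EuclideanSpace.complexify ∘ ⇑(e_f)) k' = 0) ∧
                (∀ k', k' ∈ ((Torus.freqBall (Lc / 2)).erase 0) →
                  ‖UnitAddTorus.mFourierCoeff (EuclideanSpace.complexify ∘ ⇑(e_d)) k'‖ ≤ ηz * min 1 ((E.a (m + 1) * (8 * Real.pi ^ 2 * ‖Torus.latticeVec k'‖ ^ 2 * lo * (E.cellVisc (m + 1) + c / E.cellVisc (m + 1)) / (E.N (m + 1) : ℝ) ^ 2)) * (s' - (j : ℝ) * E.refresh (m + 1))) * ‖UnitAddTorus.mFourierCoeff (EuclideanSpace.complexify ∘ ⇑(Um1 0 ((j : ℝ) * E.refresh (m + 1)) (datumLp w₁ hw₁))) k'‖) ∧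
                (∀ y : V2, |⟪y, e_c⟫_ℝ| ≤ ηz
                  * Real.sqrt (∑ k' ∈ ((Torus.freqBall (Lc / 2)).erase 0), min 1 ((E.a (m + 1) * (8 * Real.pi ^ 2 * ‖Torus.latticeVec k'‖ ^ 2 * lo * (E.cellVisc (m + 1) + c / E.cellVisc (m + 1)) / (E.N (m + 1) : ℝ) ^ 2)) * (s' - (j : ℝ) * E.refresh (m + 1))) * ‖UnitAddTorus.mFourierCoeff (EuclideanSpace.complexify ∘ ⇑(Um1 0 ((j : ℝ) * E.refresh (m + 1)) (datumLp w₁ hw₁))) k'‖ ^ 2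
                      + (‖Um1 0 ((j : ℝ) * E.refresh (m + 1)) (datumLp w₁ hw₁)‖ ^ 2 - ∑ k' ∈ ((Torus.freqBall (Lc / 2)).erase 0), ‖UnitAddTorus.mFourierCoeff (EuclideanSpace.complexify ∘ ⇑(Um1 0 ((j : ℝ) * E.refresh (m + 1)) (datumLp w₁ hw₁))) k'‖ ^ 2))
                  * Real.sqrt (∑ k' ∈ ((Torus.freqBall (Lc / 2)).erase 0), min 1 ((E.a (m + 1) * (8 * Real.pi ^ 2 * ‖Torus.latticeVec k'‖ ^ 2 * lo * (E.cellVisc (m + 1) + c / E.cellVisc (m + 1)) / (E.N (m + 1) : ℝ) ^ 2)) * (s' - (j : ℝ) * E.refresh (m + 1))) * ‖UnitAddTorus.mFourierCoeff (EuclideanSpace.complexify ∘ ⇑(y)) k'‖ ^ 2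
                      + (‖y‖ ^ 2 - ∑ k' ∈ ((Torus.freqBall (Lc / 2)).erase 0), ‖UnitAddTorus.mFourierCoeff (EuclideanSpace.complexify ∘ ⇑(y)) k'‖ ^ 2))) ∧
                (∑ k' ∈ ((Torus.freqBall (Lc / 2)).erase 0), ‖UnitAddTorus.mFourierCoeff (EuclideanSpace.complexify ∘ ⇑(e_l)) k'‖ ^ 2 / (ηz ^ 2 * min 1 ((E.a (m + 1) * (8 * Real.pi ^ 2 * ‖Torus.latticeVec k'‖ ^ 2 * lo * (E.cellVisc (m + 1) + c / E.cellVisc (m + 1)) / (E.N (m + 1) : ℝ) ^ 2)) * (s' - (j : ℝ) * E.refresh (m + 1))))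
                  ≤ ‖Um1 0 ((j : ℝ) * E.refresh (m + 1)) (datumLp w₁ hw₁)‖ ^ 2 - ∑ k' ∈ ((Torus.freqBall (Lc / 2)).erase 0), ‖UnitAddTorus.mFourierCoeff (EuclideanSpace.complexify ∘ ⇑(Um1 0 ((j : ℝ) * E.refresh (m + 1)) (datumLp w₁ hw₁))) k'‖ ^ 2) ∧
                ‖e_f‖ ≤ Real.sqrt (∑ k' ∈ ((Torus.freqBall (Lc / 2)).erase 0), ηz ^ 2 * min 1 ((E.a (m + 1) * (8 * Real.pi ^ 2 * ‖Torus.latticeVec k'‖ ^ 2 * lo * (E.cellVisc (m + 1) + c / E.cellVisc (m + 1)) / (E.N (m + 1) : ℝ) ^ 2)) * (s' - (j : ℝ) * E.refresh (m + 1))) * ‖UnitAddTorus.mFourierCoeff (EuclideanSpace.complexify ∘ ⇑(Um1 0 ((j : ℝ) * E.refresh (m + 1)) (datumLp w₁ hw₁))) k'‖ ^ 2)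
                  + ηz * Real.sqrt (‖Um1 0 ((j : ℝ) * E.refresh (m + 1)) (datumLp w₁ hw₁)‖ ^ 2 - ∑ k' ∈ ((Torus.freqBall (Lc / 2)).erase 0), ‖UnitAddTorus.mFourierCoeff (EuclideanSpace.complexify ∘ ⇑(Um1 0 ((j : ℝ) * E.refresh (m + 1)) (datumLp w₁ hw₁))) k'‖ ^ 2)) ∧
              -- (Recin) the 3×3 high-label transfer bounds of the true window map (W4/W5/W6/(M♭_G))
              ‖Q₁ (Um1 ((j : ℝ) * E.refresh (m + 1)) s' (P (Um1 0 ((j : ℝ) * E.refresh (m + 1)) (datumLp w₁ hw₁))))‖ ≤ Real.sqrt (ηz * (‖Um1 0 ((j : ℝ) * E.refresh (m + 1)) (datumLp w₁ hw₁)‖ ^ 2 - ‖Um ((j : ℝ) * E.refresh (m + 1)) s' (Um1 0 ((j : ℝ) * E.refresh (m + 1)) (datumLp w₁ hw₁))‖ ^ 2)) + ε * ‖datumLp w₁ hw₁‖ ∧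
              ‖Q₂ (Um1 ((j : ℝ) * E.refresh (m + 1)) s' (P (Um1 0 ((j : ℝ) * E.refresh (m + 1)) (datumLp w₁ hw₁))))‖ ≤ Real.sqrt (ηz * (‖Um1 0 ((j : ℝ) * E.refresh (m + 1)) (datumLp w₁ hw₁)‖ ^ 2 - ‖Um ((j : ℝ) * E.refresh (m + 1)) s' (Um1 0 ((j : ℝ) * E.refresh (m + 1)) (datumLp w₁ hw₁))‖ ^ 2)) + ε * ‖datumLp w₁ hw₁‖ ∧
              ‖Q₁ (Um1 ((j : ℝ) * E.refresh (m + 1)) s' (Q₁ (Um1 0 ((j : ℝ) * E.refresh (m + 1)) (datumLp w₁ hw₁))))‖ ≤ ηz * ‖Q₁ (Um1 0 ((j : ℝ) * E.refresh (m + 1)) (datumLp w₁ hw₁))‖ + ε * ‖datumLp w₁ hw₁‖ ∧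
              ‖Q₂ (Um1 ((j : ℝ) * E.refresh (m + 1)) s' (Q₁ (Um1 0 ((j : ℝ) * E.refresh (m + 1)) (datumLp w₁ hw₁))))‖ ≤ ηz * ‖Q₁ (Um1 0 ((j : ℝ) * E.refresh (m + 1)) (datumLp w₁ hw₁))‖ + ε * ‖datumLp w₁ hw₁‖ ∧
              ‖Q₁ (Um1 ((j : ℝ) * E.refresh (m + 1)) s' (Q₂ (Um1 0 ((j : ℝ) * E.refresh (m + 1)) (datumLp w₁ hw₁))))‖ ≤ ηz * ‖Q₂ (Um1 0 ((j : ℝ) * E.refresh (m + 1)) (datumLp w₁ hw₁))‖ + ε * ‖datumLp w₁ hw₁‖ ∧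
              ‖Q₂ (Um1 ((j : ℝ) * E.refresh (m + 1)) s' (Q₂ (Um1 0 ((j : ℝ) * E.refresh (m + 1)) (datumLp w₁ hw₁))))‖ ≤ 1 / 2 * ‖Q₂ (Um1 0 ((j : ℝ) * E.refresh (m + 1)) (datumLp w₁ hw₁))‖ + ε * ‖datumLp w₁ hw₁‖ := by
  sorry


/-! ## §9a–§9d (v29, lead g3) PROVIDER-SIZED PARTS of §9 with CANONICAL pieces — glue `cellInputs_of_parts : §9a → §9b → §9c → §9d → §9` is the
lead's next landing.  Fixed objects: the slow-low set `S = freqBall (Lc/2) ∖ {0}` with its frequency projector `PS`, the low-label class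
`A = {k : dist(k, N(m+1)ℤ³) ≤ Lc/2}` with its label projector `P` (both characterised, `∀`-quantified); canonical pieces of the low-label window error
`e = P(Uu − Tu)`: SLOW BLOCK `PS(U − T)PS u = e_d + e_c` (§9a: diagonal (V_G) [W6] + cross (X_G⁺) [lead]), LEAK `e_l = PS(U − T)(u − PS u)`
(§9b, x-weighted (F_G⁺) [W5]), FAST/CORRECTOR `e_f = (P − PS)(U − T)u` (§9c, (C_G⁺)/(M♭_G) [W5/W6]), and the six transfer bounds with the
provider's mid/high classes `B, C` (§9d, W4 + (H)).  Each part has its own small scale `Cz ρ^σz`; the glue takes max/min. -/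

open scoped Classical in
/-- **§9a `cellInputs_slowBlock_text` (W6 (V_G) + (X_G⁺)).**  The slow block of the window error splits into a diagonal part, relatively
`ηz·min(1, rate_k τ)`-small mode by mode, and a cross part with the dissipation-weighted Cauchy–Schwarz bound. -/
theorem cellInputs_slowBlock_text : ∀ k (W : Literature.Analysis.FluidPDE.LatticeShear.LatticeWord k) (M : ℝ) (hM : 0 < M) (c : ℝ), 0 < c →
    ∀ (Φ : ℝ → Torus.Visc4 (Fin 3) → Torus.Visc4 (Fin 3)) (lo hi Λ β σ C ν₀ K Cf νf Kf : ℝ),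
      0 < lo → lo ≤ 1 → 1 ≤ hi → 1 < Λ → 0 ≤ β →
      0 < σ → 0 ≤ C → 0 < ν₀ → 0 < K → SlowVectorClauseF W M hM c Φ lo hi Λ β σ C ν₀ K →
      0 ≤ Cf → 0 < νf → 0 < Kf → CellEnergyClausesW W M hM c lo hi Λ β Cf νf Kf →
      (∀ Kb : ℝ, 1 ≤ Kb → ∃ CK : ℝ, 1 ≤ CK ∧ ∃ cK > (0:ℝ), ∃ νh > (0:ℝ), HighLabelDecayW W M hM lo hi Λ β νh Kb CK cK) →
      ∃ ν₁ > (0:ℝ), ∃ K₁ > (0:ℝ), ∃ Λ₀ : ℕ, ∃ θ₀ > (0:ℝ), ∃ Cz > (0:ℝ), ∃ σz > (0:ℝ),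
        ∀ E : Literature.Analysis.FluidPDE.LatticeShear.LagrangianLatticeCarrier k, E.design = W.stretch M hM → E.gain = c → E.nu0 ≤ ν₁ → K₁ ≤ E.K →
          E.LPermissible → E.Regular → (∀ m, Λ₀ * E.N m ≤ E.N (m + 1)) → (∀ m, E.N m ^ 2 ≤ E.N (m + 1)) →
          (∀ m, E.cellVisc (m + 1) * ((E.N (m + 1) : ℝ) / E.N m) ^ (1 / 4 : ℝ) ≤ 1) →
          (∀ m, E.K * ((E.N (m + 1) : ℝ) / E.N m) ^ (1 / 4 : ℝ) ≤ ((E.N (m + 1) : ℝ) / E.N m) * E.cellVisc (m + 1)) →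
          (∀ m, E.θ (m + 1) * ((E.N (m + 1) : ℝ) / E.N m) ^ (1 / 16 : ℝ) ≤ θ₀) →
          (∀ m, ((E.N (m + 1) : ℝ) / E.N m) ^ (1 / 16 : ℝ) * E.physPeriod (m + 1) ≤ E.refresh (m + 1)) →
        ∃ mstar : ℕ, ∀ m, mstar ≤ m →
          ∀ Lc : ℕ, Lc = ⌊((E.N m : ℝ) / E.N (m + 1)) ^ (1 / 64 : ℝ) * (E.N (m + 1) * E.cellVisc (m + 1)) / Real.sqrt c⌋₊ →
          ∀ S : Torus.Visc4 (Fin 3), Torus.OddSmall S β → Torus.NearIso S lo hi →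
            Torus.OddSmall (Φ (E.cellVisc (m + 1)) S) β → Torus.NearIso (Φ (E.cellVisc (m + 1)) S) lo hi →
          ∀ Um Um1 : ℝ → ℝ → (V2 →L[ℝ] V2),
            Torus.IsPropagator 1 (E.partialSum m) (E.kbar m • renormStep (Φ (E.cellVisc (m + 1))) (E.gain / E.cellVisc (m + 1) ^ 2) S) Um →
            Torus.IsPropagator 1 (E.partialSum (m + 1)) (E.kbar (m + 1) • S) Um1 →
          ∀ ηz ε : ℝ, ηz = Cz * ((E.N m : ℝ) / E.N (m + 1)) ^ σz →
            ε = ((E.N m : ℝ) / E.N (m + 1)) ^ σz * (1 - Real.exp (-(4 * Real.pi ^ 2 * (E.kbar m * lo)))) * E.refresh (m + 1) →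
          ∀ S : Finset (Fin 3 → ℤ), S = (Torus.freqBall (Lc / 2)).erase 0 →
          ∀ PS : V2 →L[ℝ] V2, (∀ (y : V2) (k' : Fin 3 → ℤ), UnitAddTorus.mFourierCoeff (EuclideanSpace.complexify ∘ ⇑(PS y)) k' = if k' ∈ S then UnitAddTorus.mFourierCoeff (EuclideanSpace.complexify ∘ ⇑(y)) k' else 0) →
          ∀ (w₁ : VF) (hw₁ : IsDatum w₁), Torus.fourierTruncate Lc w₁ = w₁ →
            ∀ (j : ℕ) (s' : ℝ), (j : ℝ) * E.refresh (m + 1) + E.refresh (m + 1) ≤ s' →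
              s' ≤ (j : ℝ) * E.refresh (m + 1) + 2 * E.refresh (m + 1) → s' ≤ 1 →
              ∃ e_d e_c : V2,
                PS (Um1 ((j : ℝ) * E.refresh (m + 1)) s' (PS (Um1 0 ((j : ℝ) * E.refresh (m + 1)) (datumLp w₁ hw₁))) - Um ((j : ℝ) * E.refresh (m + 1)) s' (PS (Um1 0 ((j : ℝ) * E.refresh (m + 1)) (datumLp w₁ hw₁)))) = e_d + e_c ∧
                (∀ k', k' ∉ S → UnitAddTorus.mFourierCoeff (EuclideanSpace.complexify ∘ ⇑(e_d)) k' = 0) ∧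
                (∀ k', k' ∈ S →
                  ‖UnitAddTorus.mFourierCoeff (EuclideanSpace.complexify ∘ ⇑(e_d)) k'‖ ≤ ηz * min 1 ((E.a (m + 1) * (8 * Real.pi ^ 2 * ‖Torus.latticeVec k'‖ ^ 2 * lo * (E.cellVisc (m + 1) + c / E.cellVisc (m + 1)) / (E.N (m + 1) : ℝ) ^ 2)) * (s' - (j : ℝ) * E.refresh (m + 1))) * ‖UnitAddTorus.mFourierCoeff (EuclideanSpace.complexify ∘ ⇑(Um1 0 ((j : ℝ) * E.refresh (m + 1)) (datumLp w₁ hw₁))) k'‖) ∧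
                (∀ y : V2, |⟪y, e_c⟫_ℝ| ≤ ηz
                  * Real.sqrt (∑ k' ∈ S, min 1 ((E.a (m + 1) * (8 * Real.pi ^ 2 * ‖Torus.latticeVec k'‖ ^ 2 * lo * (E.cellVisc (m + 1) + c / E.cellVisc (m + 1)) / (E.N (m + 1) : ℝ) ^ 2)) * (s' - (j : ℝ) * E.refresh (m + 1))) * ‖UnitAddTorus.mFourierCoeff (EuclideanSpace.complexify ∘ ⇑(Um1 0 ((j : ℝ) * E.refresh (m + 1)) (datumLp w₁ hw₁))) k'‖ ^ 2
                      + (‖Um1 0 ((j : ℝ) * E.refresh (m + 1)) (datumLp w₁ hw₁)‖ ^ 2 - ∑ k' ∈ S, ‖UnitAddTorus.mFourierCoeff (EuclideanSpace.complexify ∘ ⇑(Um1 0 ((j : ℝ) * E.refresh (m + 1)) (datumLp w₁ hw₁))) k'‖ ^ 2))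
                  * Real.sqrt (∑ k' ∈ S, min 1 ((E.a (m + 1) * (8 * Real.pi ^ 2 * ‖Torus.latticeVec k'‖ ^ 2 * lo * (E.cellVisc (m + 1) + c / E.cellVisc (m + 1)) / (E.N (m + 1) : ℝ) ^ 2)) * (s' - (j : ℝ) * E.refresh (m + 1))) * ‖UnitAddTorus.mFourierCoeff (EuclideanSpace.complexify ∘ ⇑(y)) k'‖ ^ 2
                      + (‖y‖ ^ 2 - ∑ k' ∈ S, ‖UnitAddTorus.mFourierCoeff (EuclideanSpace.complexify ∘ ⇑(y)) k'‖ ^ 2))) := by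
  sorry

open scoped Classical in
/-- **§9b `cellInputs_leak_text` (W5 (F_G⁺)).**  Deposits from the non-slow content of the state into slow modes are x-weighted small:
`Σ_S ‖𝓕(PS(U − T)(u − PS u))(k)‖²/(ηz² min(1, rate_k τ)) ≤ ‖u − PS u‖²`. -/
theorem cellInputs_leak_text : ∀ k (W : Literature.Analysis.FluidPDE.LatticeShear.LatticeWord k) (M : ℝ) (hM : 0 < M) (c : ℝ), 0 < c →
    ∀ (Φ : ℝ → Torus.Visc4 (Fin 3) → Torus.Visc4 (Fin 3)) (lo hi Λ β σ C ν₀ K Cf νf Kf : ℝ),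
      0 < lo → lo ≤ 1 → 1 ≤ hi → 1 < Λ → 0 ≤ β →
      0 < σ → 0 ≤ C → 0 < ν₀ → 0 < K → SlowVectorClauseF W M hM c Φ lo hi Λ β σ C ν₀ K →
      0 ≤ Cf → 0 < νf → 0 < Kf → CellEnergyClausesW W M hM c lo hi Λ β Cf νf Kf →
      (∀ Kb : ℝ, 1 ≤ Kb → ∃ CK : ℝ, 1 ≤ CK ∧ ∃ cK > (0:ℝ), ∃ νh > (0:ℝ), HighLabelDecayW W M hM lo hi Λ β νh Kb CK cK) →
      ∃ ν₁ > (0:ℝ), ∃ K₁ > (0:ℝ), ∃ Λ₀ : ℕ, ∃ θ₀ > (0:ℝ), ∃ Cz > (0:ℝ), ∃ σz > (0:ℝ),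
        ∀ E : Literature.Analysis.FluidPDE.LatticeShear.LagrangianLatticeCarrier k, E.design = W.stretch M hM → E.gain = c → E.nu0 ≤ ν₁ → K₁ ≤ E.K →
          E.LPermissible → E.Regular → (∀ m, Λ₀ * E.N m ≤ E.N (m + 1)) → (∀ m, E.N m ^ 2 ≤ E.N (m + 1)) →
          (∀ m, E.cellVisc (m + 1) * ((E.N (m + 1) : ℝ) / E.N m) ^ (1 / 4 : ℝ) ≤ 1) →
          (∀ m, E.K * ((E.N (m + 1) : ℝ) / E.N m) ^ (1 / 4 : ℝ) ≤ ((E.N (m + 1) : ℝ) / E.N m) * E.cellVisc (m + 1)) →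
          (∀ m, E.θ (m + 1) * ((E.N (m + 1) : ℝ) / E.N m) ^ (1 / 16 : ℝ) ≤ θ₀) →
          (∀ m, ((E.N (m + 1) : ℝ) / E.N m) ^ (1 / 16 : ℝ) * E.physPeriod (m + 1) ≤ E.refresh (m + 1)) →
        ∃ mstar : ℕ, ∀ m, mstar ≤ m →
          ∀ Lc : ℕ, Lc = ⌊((E.N m : ℝ) / E.N (m + 1)) ^ (1 / 64 : ℝ) * (E.N (m + 1) * E.cellVisc (m + 1)) / Real.sqrt c⌋₊ →
          ∀ S : Torus.Visc4 (Fin 3), Torus.OddSmall S β → Torus.NearIso S lo hi →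
            Torus.OddSmall (Φ (E.cellVisc (m + 1)) S) β → Torus.NearIso (Φ (E.cellVisc (m + 1)) S) lo hi →
          ∀ Um Um1 : ℝ → ℝ → (V2 →L[ℝ] V2),
            Torus.IsPropagator 1 (E.partialSum m) (E.kbar m • renormStep (Φ (E.cellVisc (m + 1))) (E.gain / E.cellVisc (m + 1) ^ 2) S) Um →
            Torus.IsPropagator 1 (E.partialSum (m + 1)) (E.kbar (m + 1) • S) Um1 →
          ∀ ηz ε : ℝ, ηz = Cz * ((E.N m : ℝ) / E.N (m + 1)) ^ σz →
            ε = ((E.N m : ℝ) / E.N (m + 1)) ^ σz * (1 - Real.exp (-(4 * Real.pi ^ 2 * (E.kbar m * lo)))) * E.refresh (m + 1) →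
          ∀ S : Finset (Fin 3 → ℤ), S = (Torus.freqBall (Lc / 2)).erase 0 →
          ∀ PS : V2 →L[ℝ] V2, (∀ (y : V2) (k' : Fin 3 → ℤ), UnitAddTorus.mFourierCoeff (EuclideanSpace.complexify ∘ ⇑(PS y)) k' = if k' ∈ S then UnitAddTorus.mFourierCoeff (EuclideanSpace.complexify ∘ ⇑(y)) k' else 0) →
          ∀ (w₁ : VF) (hw₁ : IsDatum w₁), Torus.fourierTruncate Lc w₁ = w₁ →
            ∀ (j : ℕ) (s' : ℝ), (j : ℝ) * E.refresh (m + 1) + E.refresh (m + 1) ≤ s' →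
              s' ≤ (j : ℝ) * E.refresh (m + 1) + 2 * E.refresh (m + 1) → s' ≤ 1 →
              ∑ k' ∈ S, ‖UnitAddTorus.mFourierCoeff (EuclideanSpace.complexify ∘ ⇑(PS (Um1 ((j : ℝ) * E.refresh (m + 1)) s' (Um1 0 ((j : ℝ) * E.refresh (m + 1)) (datumLp w₁ hw₁) - PS (Um1 0 ((j : ℝ) * E.refresh (m + 1)) (datumLp w₁ hw₁))) - Um ((j : ℝ) * E.refresh (m + 1)) s' (Um1 0 ((j : ℝ) * E.refresh (m + 1)) (datumLp w₁ hw₁) - PS (Um1 0 ((j : ℝ) * E.refresh (m + 1)) (datumLp w₁ hw₁)))))) k'‖ ^ 2 / (ηz ^ 2 * min 1 ((E.a (m + 1) * (8 * Real.pi ^ 2 * ‖Torus.latticeVec k'‖ ^ 2 * lo * (E.cellVisc (m + 1) + c / E.cellVisc (m + 1)) / (E.N (m + 1) : ℝ) ^ 2)) * (s' - (j : ℝ) * E.refresh (m + 1))))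
                ≤ ‖Um1 0 ((j : ℝ) * E.refresh (m + 1)) (datumLp w₁ hw₁)‖ ^ 2 - ∑ k' ∈ S, ‖UnitAddTorus.mFourierCoeff (EuclideanSpace.complexify ∘ ⇑(Um1 0 ((j : ℝ) * E.refresh (m + 1)) (datumLp w₁ hw₁))) k'‖ ^ 2 := by
  sorry

open scoped Classical in
/-- **§9c `cellInputs_fast_text` (W5 (C_G⁺) ⊕ (M♭_G)).**  The fast-frequency, low-label part of the window error (correctors and reset
deposits) is bounded by the dissipation-weighted slow energy plus `ηz` times the non-slow energy. -/
theorem cellInputs_fast_text : ∀ k (W : Literature.Analysis.FluidPDE.LatticeShear.LatticeWord k) (M : ℝ) (hM : 0 < M) (c : ℝ), 0 < c →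
    ∀ (Φ : ℝ → Torus.Visc4 (Fin 3) → Torus.Visc4 (Fin 3)) (lo hi Λ β σ C ν₀ K Cf νf Kf : ℝ),
      0 < lo → lo ≤ 1 → 1 ≤ hi → 1 < Λ → 0 ≤ β →
      0 < σ → 0 ≤ C → 0 < ν₀ → 0 < K → SlowVectorClauseF W M hM c Φ lo hi Λ β σ C ν₀ K →
      0 ≤ Cf → 0 < νf → 0 < Kf → CellEnergyClausesW W M hM c lo hi Λ β Cf νf Kf →
      (∀ Kb : ℝ, 1 ≤ Kb → ∃ CK : ℝ, 1 ≤ CK ∧ ∃ cK > (0:ℝ), ∃ νh > (0:ℝ), HighLabelDecayW W M hM lo hi Λ β νh Kb CK cK) →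
      ∃ ν₁ > (0:ℝ), ∃ K₁ > (0:ℝ), ∃ Λ₀ : ℕ, ∃ θ₀ > (0:ℝ), ∃ Cz > (0:ℝ), ∃ σz > (0:ℝ),
        ∀ E : Literature.Analysis.FluidPDE.LatticeShear.LagrangianLatticeCarrier k, E.design = W.stretch M hM → E.gain = c → E.nu0 ≤ ν₁ → K₁ ≤ E.K →
          E.LPermissible → E.Regular → (∀ m, Λ₀ * E.N m ≤ E.N (m + 1)) → (∀ m, E.N m ^ 2 ≤ E.N (m + 1)) →
          (∀ m, E.cellVisc (m + 1) * ((E.N (m + 1) : ℝ) / E.N m) ^ (1 / 4 : ℝ) ≤ 1) →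
          (∀ m, E.K * ((E.N (m + 1) : ℝ) / E.N m) ^ (1 / 4 : ℝ) ≤ ((E.N (m + 1) : ℝ) / E.N m) * E.cellVisc (m + 1)) →
          (∀ m, E.θ (m + 1) * ((E.N (m + 1) : ℝ) / E.N m) ^ (1 / 16 : ℝ) ≤ θ₀) →
          (∀ m, ((E.N (m + 1) : ℝ) / E.N m) ^ (1 / 16 : ℝ) * E.physPeriod (m + 1) ≤ E.refresh (m + 1)) →
        ∃ mstar : ℕ, ∀ m, mstar ≤ m →
          ∀ Lc : ℕ, Lc = ⌊((E.N m : ℝ) / E.N (m + 1)) ^ (1 / 64 : ℝ) * (E.N (m + 1) * E.cellVisc (m + 1)) / Real.sqrt c⌋₊ →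
          ∀ S : Torus.Visc4 (Fin 3), Torus.OddSmall S β → Torus.NearIso S lo hi →
            Torus.OddSmall (Φ (E.cellVisc (m + 1)) S) β → Torus.NearIso (Φ (E.cellVisc (m + 1)) S) lo hi →
          ∀ Um Um1 : ℝ → ℝ → (V2 →L[ℝ] V2),
            Torus.IsPropagator 1 (E.partialSum m) (E.kbar m • renormStep (Φ (E.cellVisc (m + 1))) (E.gain / E.cellVisc (m + 1) ^ 2) S) Um →
            Torus.IsPropagator 1 (E.partialSum (m + 1)) (E.kbar (m + 1) • S) Um1 →
          ∀ ηz ε : ℝ, ηz = Cz * ((E.N m : ℝ) / E.N (m + 1)) ^ σz →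
            ε = ((E.N m : ℝ) / E.N (m + 1)) ^ σz * (1 - Real.exp (-(4 * Real.pi ^ 2 * (E.kbar m * lo)))) * E.refresh (m + 1) →
          ∀ S : Finset (Fin 3 → ℤ), S = (Torus.freqBall (Lc / 2)).erase 0 →
          ∀ PS : V2 →L[ℝ] V2, (∀ (y : V2) (k' : Fin 3 → ℤ), UnitAddTorus.mFourierCoeff (EuclideanSpace.complexify ∘ ⇑(PS y)) k' = if k' ∈ S then UnitAddTorus.mFourierCoeff (EuclideanSpace.complexify ∘ ⇑(y)) k' else 0) →
          ∀ A : Set (Fin 3 → ℤ), A = {k' : Fin 3 → ℤ | ∃ z : Fin 3 → ℤ, Torus.freqNormSq (k' - (E.N (m + 1) : ℤ) • z) ≤ (((Lc / 2 : ℕ) : ℝ)) ^ 2} →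
          ∀ P : V2 →L[ℝ] V2, (∀ (y : V2) (k' : Fin 3 → ℤ), UnitAddTorus.mFourierCoeff (EuclideanSpace.complexify ∘ ⇑(P y)) k' = if k' ∈ A then UnitAddTorus.mFourierCoeff (EuclideanSpace.complexify ∘ ⇑(y)) k' else 0) →
          ∀ (w₁ : VF) (hw₁ : IsDatum w₁), Torus.fourierTruncate Lc w₁ = w₁ →
            ∀ (j : ℕ) (s' : ℝ), (j : ℝ) * E.refresh (m + 1) + E.refresh (m + 1) ≤ s' →
              s' ≤ (j : ℝ) * E.refresh (m + 1) + 2 * E.refresh (m + 1) → s' ≤ 1 →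
              ‖P (Um1 ((j : ℝ) * E.refresh (m + 1)) s' (Um1 0 ((j : ℝ) * E.refresh (m + 1)) (datumLp w₁ hw₁)) - Um ((j : ℝ) * E.refresh (m + 1)) s' (Um1 0 ((j : ℝ) * E.refresh (m + 1)) (datumLp w₁ hw₁))) - PS (Um1 ((j : ℝ) * E.refresh (m + 1)) s' (Um1 0 ((j : ℝ) * E.refresh (m + 1)) (datumLp w₁ hw₁)) - Um ((j : ℝ) * E.refresh (m + 1)) s' (Um1 0 ((j : ℝ) * E.refresh (m + 1)) (datumLp w₁ hw₁)))‖
                ≤ Real.sqrt (∑ k' ∈ S, ηz ^ 2 * min 1 ((E.a (m + 1) * (8 * Real.pi ^ 2 * ‖Torus.latticeVec k'‖ ^ 2 * lo * (E.cellVisc (m + 1) + c / E.cellVisc (m + 1)) / (E.N (m + 1) : ℝ) ^ 2)) * (s' - (j : ℝ) * E.refresh (m + 1))) * ‖UnitAddTorus.mFourierCoeff (EuclideanSpace.complexify ∘ ⇑(Um1 0 ((j : ℝ) * E.refresh (m + 1)) (datumLp w₁ hw₁))) k'‖ ^ 2)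
                  + ηz * Real.sqrt (‖Um1 0 ((j : ℝ) * E.refresh (m + 1)) (datumLp w₁ hw₁)‖ ^ 2 - ∑ k' ∈ S, ‖UnitAddTorus.mFourierCoeff (EuclideanSpace.complexify ∘ ⇑(Um1 0 ((j : ℝ) * E.refresh (m + 1)) (datumLp w₁ hw₁))) k'‖ ^ 2) := by
  sorry

open scoped Classical in
/-- **§9d `cellInputs_rec_text` (W4 S3e⁺ + W6 + (H)/(M♭_G)).**  The provider picks the mid/high label classes `B, C` completing `A` to a
symmetric partition with `C ⊆ {|k|² > Lc²}` and delivers the six transfer bounds of the true window map. -/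
theorem cellInputs_rec_text : ∀ k (W : Literature.Analysis.FluidPDE.LatticeShear.LatticeWord k) (M : ℝ) (hM : 0 < M) (c : ℝ), 0 < c →
    ∀ (Φ : ℝ → Torus.Visc4 (Fin 3) → Torus.Visc4 (Fin 3)) (lo hi Λ β σ C ν₀ K Cf νf Kf : ℝ),
      0 < lo → lo ≤ 1 → 1 ≤ hi → 1 < Λ → 0 ≤ β →
      0 < σ → 0 ≤ C → 0 < ν₀ → 0 < K → SlowVectorClauseF W M hM c Φ lo hi Λ β σ C ν₀ K →
      0 ≤ Cf → 0 < νf → 0 < Kf → CellEnergyClausesW W M hM c lo hi Λ β Cf νf Kf →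
      (∀ Kb : ℝ, 1 ≤ Kb → ∃ CK : ℝ, 1 ≤ CK ∧ ∃ cK > (0:ℝ), ∃ νh > (0:ℝ), HighLabelDecayW W M hM lo hi Λ β νh Kb CK cK) →
      ∃ ν₁ > (0:ℝ), ∃ K₁ > (0:ℝ), ∃ Λ₀ : ℕ, ∃ θ₀ > (0:ℝ), ∃ Cz > (0:ℝ), ∃ σz > (0:ℝ),
        ∀ E : Literature.Analysis.FluidPDE.LatticeShear.LagrangianLatticeCarrier k, E.design = W.stretch M hM → E.gain = c → E.nu0 ≤ ν₁ → K₁ ≤ E.K →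
          E.LPermissible → E.Regular → (∀ m, Λ₀ * E.N m ≤ E.N (m + 1)) → (∀ m, E.N m ^ 2 ≤ E.N (m + 1)) →
          (∀ m, E.cellVisc (m + 1) * ((E.N (m + 1) : ℝ) / E.N m) ^ (1 / 4 : ℝ) ≤ 1) →
          (∀ m, E.K * ((E.N (m + 1) : ℝ) / E.N m) ^ (1 / 4 : ℝ) ≤ ((E.N (m + 1) : ℝ) / E.N m) * E.cellVisc (m + 1)) →
          (∀ m, E.θ (m + 1) * ((E.N (m + 1) : ℝ) / E.N m) ^ (1 / 16 : ℝ) ≤ θ₀) →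
          (∀ m, ((E.N (m + 1) : ℝ) / E.N m) ^ (1 / 16 : ℝ) * E.physPeriod (m + 1) ≤ E.refresh (m + 1)) →
        ∃ mstar : ℕ, ∀ m, mstar ≤ m →
          ∀ Lc : ℕ, Lc = ⌊((E.N m : ℝ) / E.N (m + 1)) ^ (1 / 64 : ℝ) * (E.N (m + 1) * E.cellVisc (m + 1)) / Real.sqrt c⌋₊ →
          ∀ S : Torus.Visc4 (Fin 3), Torus.OddSmall S β → Torus.NearIso S lo hi →
            Torus.OddSmall (Φ (E.cellVisc (m + 1)) S) β → Torus.NearIso (Φ (E.cellVisc (m + 1)) S) lo hi →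
          ∀ Um Um1 : ℝ → ℝ → (V2 →L[ℝ] V2),
            Torus.IsPropagator 1 (E.partialSum m) (E.kbar m • renormStep (Φ (E.cellVisc (m + 1))) (E.gain / E.cellVisc (m + 1) ^ 2) S) Um →
            Torus.IsPropagator 1 (E.partialSum (m + 1)) (E.kbar (m + 1) • S) Um1 →
          ∀ ηz ε : ℝ, ηz = Cz * ((E.N m : ℝ) / E.N (m + 1)) ^ σz →
            ε = ((E.N m : ℝ) / E.N (m + 1)) ^ σz * (1 - Real.exp (-(4 * Real.pi ^ 2 * (E.kbar m * lo)))) * E.refresh (m + 1) →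
          ∀ A : Set (Fin 3 → ℤ), A = {k' : Fin 3 → ℤ | ∃ z : Fin 3 → ℤ, Torus.freqNormSq (k' - (E.N (m + 1) : ℤ) • z) ≤ (((Lc / 2 : ℕ) : ℝ)) ^ 2} →
          ∃ B C : Set (Fin 3 → ℤ),
            (∀ k', k' ∈ B ↔ -k' ∈ B) ∧ (∀ k', k' ∈ C ↔ -k' ∈ C) ∧
            (∀ k', k' ∈ A → k' ∉ B) ∧ (∀ k', k' ∈ A → k' ∉ C) ∧ (∀ k', k' ∈ B → k' ∉ C) ∧ (∀ k', k' ∈ A ∨ k' ∈ B ∨ k' ∈ C) ∧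
            (∀ k', k' ∈ C → ((Lc : ℝ)) ^ 2 < Torus.freqNormSq k') ∧
          ∀ P Q₁ Q₂ : V2 →L[ℝ] V2,
            (∀ (y : V2) (k' : Fin 3 → ℤ), UnitAddTorus.mFourierCoeff (EuclideanSpace.complexify ∘ ⇑(P y)) k' = if k' ∈ A then UnitAddTorus.mFourierCoeff (EuclideanSpace.complexify ∘ ⇑(y)) k' else 0) →
            (∀ (y : V2) (k' : Fin 3 → ℤ), UnitAddTorus.mFourierCoeff (EuclideanSpace.complexify ∘ ⇑(Q₁ y)) k' = if k' ∈ B then UnitAddTorus.mFourierCoeff (EuclideanSpace.complexify ∘ ⇑(y)) k' else 0) →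
            (∀ (y : V2) (k' : Fin 3 → ℤ), UnitAddTorus.mFourierCoeff (EuclideanSpace.complexify ∘ ⇑(Q₂ y)) k' = if k' ∈ C then UnitAddTorus.mFourierCoeff (EuclideanSpace.complexify ∘ ⇑(y)) k' else 0) →
          ∀ (w₁ : VF) (hw₁ : IsDatum w₁), Torus.fourierTruncate Lc w₁ = w₁ →
            ∀ (j : ℕ) (s' : ℝ), (j : ℝ) * E.refresh (m + 1) + E.refresh (m + 1) ≤ s' →
              s' ≤ (j : ℝ) * E.refresh (m + 1) + 2 * E.refresh (m + 1) → s' ≤ 1 →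
              ‖Q₁ (Um1 ((j : ℝ) * E.refresh (m + 1)) s' (P (Um1 0 ((j : ℝ) * E.refresh (m + 1)) (datumLp w₁ hw₁))))‖ ≤ Real.sqrt (ηz * (‖Um1 0 ((j : ℝ) * E.refresh (m + 1)) (datumLp w₁ hw₁)‖ ^ 2 - ‖Um ((j : ℝ) * E.refresh (m + 1)) s' (Um1 0 ((j : ℝ) * E.refresh (m + 1)) (datumLp w₁ hw₁))‖ ^ 2)) + ε * ‖datumLp w₁ hw₁‖ ∧
              ‖Q₂ (Um1 ((j : ℝ) * E.refresh (m + 1)) s' (P (Um1 0 ((j : ℝ) * E.refresh (m + 1)) (datumLp w₁ hw₁))))‖ ≤ Real.sqrt (ηz * (‖Um1 0 ((j : ℝ) * E.refresh (m + 1)) (datumLp w₁ hw₁)‖ ^ 2 - ‖Um ((j : ℝ) * E.refresh (m + 1)) s' (Um1 0 ((j : ℝ) * E.refresh (m + 1)) (datumLp w₁ hw₁))‖ ^ 2)) + ε * ‖datumLp w₁ hw₁‖ ∧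
              ‖Q₁ (Um1 ((j : ℝ) * E.refresh (m + 1)) s' (Q₁ (Um1 0 ((j : ℝ) * E.refresh (m + 1)) (datumLp w₁ hw₁))))‖ ≤ ηz * ‖Q₁ (Um1 0 ((j : ℝ) * E.refresh (m + 1)) (datumLp w₁ hw₁))‖ + ε * ‖datumLp w₁ hw₁‖ ∧
              ‖Q₂ (Um1 ((j : ℝ) * E.refresh (m + 1)) s' (Q₁ (Um1 0 ((j : ℝ) * E.refresh (m + 1)) (datumLp w₁ hw₁))))‖ ≤ ηz * ‖Q₁ (Um1 0 ((j : ℝ) * E.refresh (m + 1)) (datumLp w₁ hw₁))‖ + ε * ‖datumLp w₁ hw₁‖ ∧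
              ‖Q₁ (Um1 ((j : ℝ) * E.refresh (m + 1)) s' (Q₂ (Um1 0 ((j : ℝ) * E.refresh (m + 1)) (datumLp w₁ hw₁))))‖ ≤ ηz * ‖Q₂ (Um1 0 ((j : ℝ) * E.refresh (m + 1)) (datumLp w₁ hw₁))‖ + ε * ‖datumLp w₁ hw₁‖ ∧
              ‖Q₂ (Um1 ((j : ℝ) * E.refresh (m + 1)) s' (Q₂ (Um1 0 ((j : ℝ) * E.refresh (m + 1)) (datumLp w₁ hw₁))))‖ ≤ 1 / 2 * ‖Q₂ (Um1 0 ((j : ℝ) * E.refresh (m + 1)) (datumLp w₁ hw₁))‖ + ε * ‖datumLp w₁ hw₁‖ := by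
  sorry

/-! ## §9z (v31, lead g4) THE BILINEAR CUT — ONE provider text replacing §9a/§9b/§9c.  By the propagator-level duality
`Theorems/…LagrangianStepWindowDuality` (p679212: `⟪U₁ s t φ, y⟫ − ⟪U₂ s t φ, y⟫ = ∫_{(0,t−s]} cross density(w σ, ψ(t−s−σ); b₁−b₂, 𝔸₁−𝔸₂) dσ`
for every weak solution `w` of problem 1 restarted at `s` and every adjoint solution `ψ` of problem 2 from `y` at `t`), the pairing
`⟪(Um1 − Um) x, y⟫` of ONE grid window is the time integral of the cross density between the TRUE solution from `x` and the COARSE ADJOINT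
solution from `y` (carrier difference `= level (m+1)`, tensor difference `= −𝔼 = kbar(m+1)•S − kbar m • renormStep …`).  Hence the natural
analytic target is a single dissipation-weighted bilinear estimate, for ALL `x, y ∈ V2`:
  (BIL) `|⟪Um1 (jr) s' x − Um (jr) s' x, y⟫| ≤ ηz · N(x) · N(y)`, `N(v)² = Σ_{k∈S} min(1, rate_k·(s'−jr)) ‖𝓕v(k)‖² + (‖v‖² − Σ_{k∈S} ‖𝓕v(k)‖²)`.
KERNEL-CHECKED REDUCTION (landed): `…CellInputsBilinear` (p679549: `slowBlock_of_bilinear` (§9a with `e_d := 0`), `leak_of_bilinear` (§9b by weighted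
`ℓ²(S)` duality), `fast_of_bilinear` (§9c by testing against itself)) and `…CellInputsOfBilinearParts` / `…CellInputsOfBilinear`
(`cellInputs_of_bilinear : §9z → §9d → §9`).  So `stub_cellInputs ≡ §9z (BIL) + §9d (Recin)`.  Producers of §9z: Z1-op (landed) + Z3 (cell
response in the coarse frame) + Z4 (cell law on a window) + the leak/fast bookkeeping — memo L7 §1 (a)–(e); the Leray reduction to divergence-free
`x, y` is the provider's (`IsPropagator.apply_eq_apply_starProjection`, range of `U − T` divergence free). -/

open scoped Classical in
/-- **§9z `cellInputs_bilinear_text` (lead g4, split v31).**  The dissipation-weighted BILINEAR window-error bound (BIL); implies §9a ∧ §9b ∧ §9c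
(`…CellInputsOfBilinearParts`). -/
theorem cellInputs_bilinear_text : ∀ k (W : Literature.Analysis.FluidPDE.LatticeShear.LatticeWord k) (M : ℝ) (hM : 0 < M) (c : ℝ), 0 < c →
    ∀ (Φ : ℝ → Torus.Visc4 (Fin 3) → Torus.Visc4 (Fin 3)) (lo hi Λ β σ C ν₀ K Cf νf Kf : ℝ),
      0 < lo → lo ≤ 1 → 1 ≤ hi → 1 < Λ → 0 ≤ β →
      0 < σ → 0 ≤ C → 0 < ν₀ → 0 < K → SlowVectorClauseF W M hM c Φ lo hi Λ β σ C ν₀ K →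
      0 ≤ Cf → 0 < νf → 0 < Kf → CellEnergyClausesW W M hM c lo hi Λ β Cf νf Kf →
      (∀ Kb : ℝ, 1 ≤ Kb → ∃ CK : ℝ, 1 ≤ CK ∧ ∃ cK > (0:ℝ), ∃ νh > (0:ℝ), HighLabelDecayW W M hM lo hi Λ β νh Kb CK cK) →
      ∃ ν₁ > (0:ℝ), ∃ K₁ > (0:ℝ), ∃ Λ₀ : ℕ, ∃ θ₀ > (0:ℝ), ∃ Cz > (0:ℝ), ∃ σz > (0:ℝ),
        ∀ E : Literature.Analysis.FluidPDE.LatticeShear.LagrangianLatticeCarrier k, E.design = W.stretch M hM → E.gain = c → E.nu0 ≤ ν₁ → K₁ ≤ E.K →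
          E.LPermissible → E.Regular → (∀ m, Λ₀ * E.N m ≤ E.N (m + 1)) → (∀ m, E.N m ^ 2 ≤ E.N (m + 1)) →
          (∀ m, E.cellVisc (m + 1) * ((E.N (m + 1) : ℝ) / E.N m) ^ (1 / 4 : ℝ) ≤ 1) →
          (∀ m, E.K * ((E.N (m + 1) : ℝ) / E.N m) ^ (1 / 4 : ℝ) ≤ ((E.N (m + 1) : ℝ) / E.N m) * E.cellVisc (m + 1)) →
          (∀ m, E.θ (m + 1) * ((E.N (m + 1) : ℝ) / E.N m) ^ (1 / 16 : ℝ) ≤ θ₀) →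
          (∀ m, ((E.N (m + 1) : ℝ) / E.N m) ^ (1 / 16 : ℝ) * E.physPeriod (m + 1) ≤ E.refresh (m + 1)) →
        ∃ mstar : ℕ, ∀ m, mstar ≤ m →
          ∀ Lc : ℕ, Lc = ⌊((E.N m : ℝ) / E.N (m + 1)) ^ (1 / 64 : ℝ) * (E.N (m + 1) * E.cellVisc (m + 1)) / Real.sqrt c⌋₊ →
          ∀ S : Torus.Visc4 (Fin 3), Torus.OddSmall S β → Torus.NearIso S lo hi →
            Torus.OddSmall (Φ (E.cellVisc (m + 1)) S) β → Torus.NearIso (Φ (E.cellVisc (m + 1)) S) lo hi →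
          ∀ Um Um1 : ℝ → ℝ → (V2 →L[ℝ] V2),
            Torus.IsPropagator 1 (E.partialSum m) (E.kbar m • renormStep (Φ (E.cellVisc (m + 1))) (E.gain / E.cellVisc (m + 1) ^ 2) S) Um →
            Torus.IsPropagator 1 (E.partialSum (m + 1)) (E.kbar (m + 1) • S) Um1 →
          ∀ ηz ε : ℝ, ηz = Cz * ((E.N m : ℝ) / E.N (m + 1)) ^ σz →
            ε = ((E.N m : ℝ) / E.N (m + 1)) ^ σz * (1 - Real.exp (-(4 * Real.pi ^ 2 * (E.kbar m * lo)))) * E.refresh (m + 1) →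
          ∀ S : Finset (Fin 3 → ℤ), S = (Torus.freqBall (Lc / 2)).erase 0 →
          ∀ (j : ℕ) (s' : ℝ), (j : ℝ) * E.refresh (m + 1) + E.refresh (m + 1) ≤ s' →
            s' ≤ (j : ℝ) * E.refresh (m + 1) + 2 * E.refresh (m + 1) → s' ≤ 1 →
            ∀ x y : V2,
              |⟪Um1 ((j : ℝ) * E.refresh (m + 1)) s' x - Um ((j : ℝ) * E.refresh (m + 1)) s' x, y⟫_ℝ| ≤ ηz
                * Real.sqrt (∑ k' ∈ S, min 1 ((E.a (m + 1) * (8 * Real.pi ^ 2 * ‖Torus.latticeVec k'‖ ^ 2 * lo * (E.cellVisc (m + 1) + c / E.cellVisc (m + 1)) / (E.N (m + 1) : ℝ) ^ 2)) * (s' - (j : ℝ) * E.refresh (m + 1))) * ‖UnitAddTorus.mFourierCoeff (EuclideanSpace.complexify ∘ ⇑(x)) k'‖ ^ 2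
                      + (‖x‖ ^ 2 - ∑ k' ∈ S, ‖UnitAddTorus.mFourierCoeff (EuclideanSpace.complexify ∘ ⇑(x)) k'‖ ^ 2))
                * Real.sqrt (∑ k' ∈ S, min 1 ((E.a (m + 1) * (8 * Real.pi ^ 2 * ‖Torus.latticeVec k'‖ ^ 2 * lo * (E.cellVisc (m + 1) + c / E.cellVisc (m + 1)) / (E.N (m + 1) : ℝ) ^ 2)) * (s' - (j : ℝ) * E.refresh (m + 1))) * ‖UnitAddTorus.mFourierCoeff (EuclideanSpace.complexify ∘ ⇑(y)) k'‖ ^ 2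
                      + (‖y‖ ^ 2 - ∑ k' ∈ S, ‖UnitAddTorus.mFourierCoeff (EuclideanSpace.complexify ∘ ⇑(y)) k'‖ ^ 2)) := by
  sorry

end

end Summit.AnomalousDissipation.AnomalousDissipation.Cruxes.LagrangianRenormalisationStepDesign.OneLevelSplit.S23
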